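import Literature.Analysis.FluidPDE.SuitableWeakExhaustion
import Literature.Analysis.FluidPDE.ClassicalSuitable
import Literature.Analysis.FunctionSpaces.LpPairingLimits
import Literature.Analysis.FunctionSpaces.WeakLimitLpBounds
import HarnessLib

/-!
# Stability of suitable weak solutions under the compactness-method convergences

Analysis/FluidPDE theorem file (no new definitions, no named facts). The classical statement
"a limit of suitable weak solutions is a suitable weak solution" in the form used by every
compactness argument for the Navier–Stokes equations (Caffarelli–Kohn–Nirenberg 1982, remark
after (2.5) and Appendix; Lin 1998, Thm. 2.2; Lemarié-Rieusset 2016, Thm. 14.1, Steps 3–4;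
Bradshaw–Tsai 2019, §4.3: "the right hand sides of the energy inequality for `v^{(k)}` converge
… while the left hand-sides are lower semi-continuous (cf. [CKN]). The local energy inequality
for `v` plainly follows"):

* `isSuitableWeakSolutionOn_of_tendsto` — on an open space–time region `Q` of finite measure,
  let `(vₖ, πₖ)` be suitable weak solutions (viscosity `ν ≥ 0`, no force) with weak spatial
  gradients `Gₖ`, `vₖ ∈ L³(Q)`, `‖πₖ‖_{L^{3/2}(Q)}` bounded; if `vₖ → u` in `L³(Q)`,
  `πₖ ⇀ p` weakly in `L^{3/2}(Q)` (tested against `L³(Q)`), and `Gₖ a ⇀ G a` weakly in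
  `L²(Q; E)` for every direction `a`, where `G` is a weak spatial gradient of `u` with
  `∫_Q |G|² < ∞`, `p ∈ L^{3/2}(Q)` and `u ∈ L^∞_t L²_x` locally, then `(u, p)` is a suitable
  weak solution on `Q`: the distributional equations pass to the limit (the quadratic term needs
  only `L²`), the right-hand side of the local energy inequality converges (the cubic term by
  the `L³` convergence, the pressure term as a weak–strong product) and its left-hand side is
  weakly lower semicontinuous.

Supporting convergence lemmas on a finite measure space (`tendsto_integral_inner_of_tendsto_eLpNorm_two_bdd`,
`tendsto_integral_inner_clm_apply_of_tendsto_eLpNorm`, `tendsto_integral_norm_sq_mul_inner`,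
`tendsto_integral_mul_inner_of_weak_strong`) and the conversion between the iterated integrals of
`IsSuitableWeakSolutionOn` and set integrals over `Q` (`integral_integral_eq_setIntegral`).

## References

* L. Caffarelli, R. Kohn, L. Nirenberg, CPAM 35 (1982), §2 (2.5) and Appendix.
  [CaffarelliKohnNirenberg1982]
* F. Lin, CPAM 51 (1998), Thm. 2.2. [Lin1998]
* P. G. Lemarié-Rieusset, *The Navier–Stokes problem in the 21st century* (2016), Thm. 14.1.
  [Lemarierieusset2016]
* Z. Bradshaw, T.-P. Tsai, Analysis & PDE 12 (2019) = arXiv:1801.08060, §4.3. [BradshawTsai2019]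
-/

noncomputable section

open MeasureTheory TopologicalSpace Set Function Filter Metric
open scoped ENNReal NNReal Topology InnerProductSpace RealInnerProductSpace Laplacian

namespace Literature.Analysis.FluidPDE

/-! ### Convergence of pairings on a finite measure space -/

section Pairings

variable {X : Type*} [MeasurableSpace X] {μ : Measure X}
variable {E : Type*} [NormedAddCommGroup E] [InnerProductSpace ℝ E]

/-- `∫⁻ ‖f‖ₑ ≤ μ(univ)^{1/2} ‖f‖_{L²}` (Cauchy–Schwarz against `1`). [folklore] -/
theorem lintegral_enorm_le_measure_univ_mul_eLpNorm_two {F : Type*} [NormedAddCommGroup F]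
    {f : X → F} (hf : AEStronglyMeasurable f μ) :
    ∫⁻ x, ‖f x‖ₑ ∂μ ≤ μ univ ^ (1 / 2 : ℝ) * eLpNorm f 2 μ := by
  have h := eLpNorm_le_eLpNorm_mul_rpow_measure_univ (p := 1) (q := 2) one_le_two hf (μ := μ)
  rw [eLpNorm_one_eq_lintegral_enorm] at h
  simp only [ENNReal.toReal_one, ENNReal.toReal_ofNat, one_div, div_one] at h
  rw [mul_comm]
  have e : (1 : ℝ) - (2 : ℝ)⁻¹ = 1 / 2 := by norm_num
  rw [e] at h
  exact h

/-- `|∫ F| ≤ (∫⁻ ‖F‖ₑ).toReal` for real integrands, with the bound allowed to be any larger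
finite quantity. [folklore] -/
theorem abs_integral_le_toReal_of_lintegral_le {F : X → ℝ} {B : ℝ≥0∞} (hB : B ≠ ⊤)
    (h : ∫⁻ x, ‖F x‖ₑ ∂μ ≤ B) : |∫ x, F x ∂μ| ≤ B.toReal :=
  (FunctionSpaces.abs_integral_le_toReal_lintegral F).trans (ENNReal.toReal_mono hB h)

/-- **Linear pairings pass to `L²` limits**: if `fₖ, g ∈ L²(μ)` on a finite measure space,
`‖fₖ - g‖_{L²} → 0`, and `w` is a bounded measurable field, then `∫ ⟪fₖ, w⟫ → ∫ ⟪g, w⟫`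
(`|∫ ⟪fₖ - g, w⟫| ≤ C μ(X)^{1/2} ‖fₖ - g‖₂`). [folklore] -/
theorem tendsto_integral_inner_of_tendsto_eLpNorm_two_bdd [IsFiniteMeasure μ] {f : ℕ → X → E}
    {g : X → E} (hf : ∀ k, MemLp (f k) 2 μ) (hg : MemLp g 2 μ)
    (hlim : Tendsto (fun k => eLpNorm (f k - g) 2 μ) atTop (𝓝 0)) {w : X → E}
    (hw : AEStronglyMeasurable w μ) {C : ℝ} (hC0 : 0 ≤ C) (hC : ∀ x, ‖w x‖ ≤ C) :
    Tendsto (fun k => ∫ x, ⟪f k x, w x⟫ ∂μ) atTop (𝓝 (∫ x, ⟪g x, w x⟫ ∂μ)) := by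
  -- integrability of the pairings
  have hint : ∀ {h : X → E}, MemLp h 2 μ → Integrable (fun x => ⟪h x, w x⟫) μ := fun {h} hh => by
    have h1 : Integrable h μ := hh.integrable one_le_two
    refine (h1.norm.mul_const C).mono' (hh.1.inner hw) (Eventually.of_forall fun x => ?_)
    exact (norm_inner_le_norm _ _).trans (mul_le_mul_of_nonneg_left (hC x) (norm_nonneg _))
  -- the bound
  set d : ℕ → ℝ≥0∞ := fun k => ENNReal.ofReal C * (μ univ ^ (1 / 2 : ℝ) * eLpNorm (f k - g) 2 μ)
    with hd
  have hdt : Tendsto d atTop (𝓝 0) := by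
    have h1 := ENNReal.Tendsto.const_mul (a := μ univ ^ (1 / 2 : ℝ)) hlim
      (Or.inr (ENNReal.rpow_ne_top_of_nonneg (by norm_num) (measure_ne_top μ _)))
    rw [mul_zero] at h1
    have h2 := ENNReal.Tendsto.const_mul (a := ENNReal.ofReal C) h1 (Or.inr ENNReal.ofReal_ne_top)
    rw [mul_zero] at h2
    exact h2
  have hdr : Tendsto (fun k => (d k).toReal) atTop (𝓝 0) := by
    have h := (ENNReal.tendsto_toReal ENNReal.zero_ne_top).comp hdt
    rwa [ENNReal.toReal_zero] at h
  have hdtop : ∀ k, d k ≠ ⊤ := fun k => ENNReal.mul_ne_top ENNReal.ofReal_ne_top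
    (ENNReal.mul_ne_top (ENNReal.rpow_ne_top_of_nonneg (by norm_num) (measure_ne_top μ _))
      ((hf k).sub hg).eLpNorm_ne_top)
  rw [tendsto_iff_norm_sub_tendsto_zero]
  refine squeeze_zero (fun k => norm_nonneg _) (fun k => ?_) hdr
  rw [Real.norm_eq_abs, ← integral_sub (hint (hf k)) (hint hg)]
  simp_rw [← inner_sub_left]
  refine abs_integral_le_toReal_of_lintegral_le (hdtop k) ?_
  have hm : AEMeasurable (fun x => ‖f k x - g x‖ₑ) μ := ((hf k).1.sub hg.1).enorm
  calc ∫⁻ x, ‖⟪f k x - g x, w x⟫‖ₑ ∂μ ≤ ∫⁻ x, ENNReal.ofReal C * ‖f k x - g x‖ₑ ∂μ := by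
        refine lintegral_mono fun x => ?_
        rw [← ofReal_norm, ← ofReal_norm, ← ENNReal.ofReal_mul hC0]
        refine ENNReal.ofReal_le_ofReal ?_
        rw [mul_comm]
        exact (norm_inner_le_norm _ _).trans (mul_le_mul_of_nonneg_left (hC x) (norm_nonneg _))
    _ = ENNReal.ofReal C * ∫⁻ x, ‖f k x - g x‖ₑ ∂μ := lintegral_const_mul'' _ hm
    _ ≤ ENNReal.ofReal C * (μ univ ^ (1 / 2 : ℝ) * eLpNorm (f k - g) 2 μ) := by
        gcongr
        exact lintegral_enorm_le_measure_univ_mul_eLpNorm_two ((hf k).1.sub hg.1)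
    _ = d k := rfl

/-- **Quadratic pairings pass to `L²` limits**: if `fₖ, g ∈ L²(μ)`, `‖fₖ - g‖_{L²} → 0`, and
`L` is a bounded measurable operator field, then `∫ ⟪fₖ, L fₖ⟫ → ∫ ⟪g, L g⟫` (the convective
term `∫ ⟪u, (u·∇)ψ⟫ = ∫ ⟪u, Dψ u⟫ of the weak Navier–Stokes equations;
`|⟪a, La⟫ - ⟪b, Lb⟫| ≤ ‖L‖ ‖a - b‖ (‖a‖ + ‖b‖)` and Cauchy–Schwarz). [folklore] -/
theorem tendsto_integral_inner_clm_apply_of_tendsto_eLpNorm [IsFiniteMeasure μ]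
    {f : ℕ → X → E} {g : X → E} (hf : ∀ k, MemLp (f k) 2 μ) (hg : MemLp g 2 μ)
    (hlim : Tendsto (fun k => eLpNorm (f k - g) 2 μ) atTop (𝓝 0)) {L : X → E →L[ℝ] E}
    (hL : AEStronglyMeasurable L μ) {C : ℝ} (hC0 : 0 ≤ C) (hC : ∀ x, ‖L x‖ ≤ C) :
    Tendsto (fun k => ∫ x, ⟪f k x, L x (f k x)⟫ ∂μ) atTop (𝓝 (∫ x, ⟪g x, L x (g x)⟫ ∂μ)) := by
  have happ : Continuous (uncurry fun (T : E →L[ℝ] E) (v : E) => T v) :=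
    isBoundedBilinearMap_apply.continuous
  -- integrability of the pairings
  have hint : ∀ {h : X → E}, MemLp h 2 μ → Integrable (fun x => ⟪h x, L x (h x)⟫) μ := by
    intro h hh
    have hm : AEStronglyMeasurable (fun x => L x (h x)) μ := happ.comp_aestronglyMeasurable₂ hL hh.1
    have h2 : Integrable (fun x => ‖h x‖ ^ 2) μ := (memLp_two_iff_integrable_sq_norm hh.1).1 hh
    refine (h2.const_mul C).mono' (hh.1.inner hm) (Eventually.of_forall fun x => ?_)
    calc ‖⟪h x, L x (h x)⟫‖ ≤ ‖h x‖ * ‖L x (h x)‖ := norm_inner_le_norm _ _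
      _ ≤ ‖h x‖ * (C * ‖h x‖) := by
          gcongr
          exact (ContinuousLinearMap.le_opNorm _ _).trans
            (mul_le_mul_of_nonneg_right (hC x) (norm_nonneg _))
      _ = C * ‖h x‖ ^ 2 := by ring
  -- the bound
  set d : ℕ → ℝ≥0∞ := fun k => ENNReal.ofReal C *
    (eLpNorm (f k - g) 2 μ * (eLpNorm (f k - g) 2 μ + 2 * eLpNorm g 2 μ)) with hd
  have hG2 : 2 * eLpNorm g 2 μ ≠ ⊤ := ENNReal.mul_ne_top ENNReal.ofNat_ne_top hg.2.ne
  have hdt : Tendsto d atTop (𝓝 0) := by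
    have h1 : Tendsto (fun k => eLpNorm (f k - g) 2 μ + 2 * eLpNorm g 2 μ) atTop
        (𝓝 (0 + 2 * eLpNorm g 2 μ)) := hlim.add tendsto_const_nhds
    have h2 := ENNReal.Tendsto.mul hlim (Or.inr (by simpa using hG2)) h1 (Or.inr ENNReal.zero_ne_top)
    rw [zero_mul] at h2
    have h3 := ENNReal.Tendsto.const_mul (a := ENNReal.ofReal C) h2 (Or.inr ENNReal.ofReal_ne_top)
    simpa [hd] using h3
  have hdr : Tendsto (fun k => (d k).toReal) atTop (𝓝 0) := by
    have h := (ENNReal.tendsto_toReal ENNReal.zero_ne_top).comp hdt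
    rwa [ENNReal.toReal_zero] at h
  have hdtop : ∀ k, d k ≠ ⊤ := fun k => ENNReal.mul_ne_top ENNReal.ofReal_ne_top
    (ENNReal.mul_ne_top ((hf k).sub hg).eLpNorm_ne_top
      (ENNReal.add_ne_top.2 ⟨((hf k).sub hg).eLpNorm_ne_top, hG2⟩))
  rw [tendsto_iff_norm_sub_tendsto_zero]
  refine squeeze_zero (fun k => norm_nonneg _) (fun k => ?_) hdr
  rw [Real.norm_eq_abs, ← integral_sub (hint (hf k)) (hint hg)]
  refine abs_integral_le_toReal_of_lintegral_le (hdtop k) ?_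
  -- pointwise bound
  have hpt : ∀ x, ‖⟪f k x, L x (f k x)⟫ - ⟪g x, L x (g x)⟫‖ₑ ≤
      ENNReal.ofReal C * (‖f k x - g x‖ₑ * (‖f k x‖ₑ + ‖g x‖ₑ)) := fun x => by
    rw [← ofReal_norm, ← ofReal_norm, ← ofReal_norm, ← ofReal_norm,
      ← ENNReal.ofReal_add (norm_nonneg _) (norm_nonneg _),
      ← ENNReal.ofReal_mul (norm_nonneg _), ← ENNReal.ofReal_mul hC0]
    refine ENNReal.ofReal_le_ofReal ?_
    have e : ⟪f k x, L x (f k x)⟫ - ⟪g x, L x (g x)⟫ =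
        ⟪f k x - g x, L x (f k x)⟫ + ⟪g x, L x (f k x - g x)⟫ := by
      simp only [inner_sub_left, map_sub, inner_sub_right]; ring
    rw [e]
    have hLb : ∀ v, ‖L x v‖ ≤ C * ‖v‖ := fun v =>
      (ContinuousLinearMap.le_opNorm _ _).trans (mul_le_mul_of_nonneg_right (hC x) (norm_nonneg _))
    calc ‖⟪f k x - g x, L x (f k x)⟫ + ⟪g x, L x (f k x - g x)⟫‖
        ≤ ‖⟪f k x - g x, L x (f k x)⟫‖ + ‖⟪g x, L x (f k x - g x)⟫‖ := norm_add_le _ _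
      _ ≤ ‖f k x - g x‖ * (C * ‖f k x‖) + ‖g x‖ * (C * ‖f k x - g x‖) :=
          add_le_add ((norm_inner_le_norm _ _).trans (mul_le_mul_of_nonneg_left (hLb _)
            (norm_nonneg _))) ((norm_inner_le_norm _ _).trans (mul_le_mul_of_nonneg_left (hLb _)
            (norm_nonneg _)))
      _ = C * (‖f k x - g x‖ * (‖f k x‖ + ‖g x‖)) := by ring
  have hF : AEMeasurable (fun x => ‖f k x - g x‖ₑ) μ := ((hf k).1.sub hg.1).enorm
  have hG : AEMeasurable (fun x => ‖f k x‖ₑ + ‖g x‖ₑ) μ := (hf k).1.enorm.add hg.1.enorm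
  calc ∫⁻ x, ‖⟪f k x, L x (f k x)⟫ - ⟪g x, L x (g x)⟫‖ₑ ∂μ
      ≤ ∫⁻ x, ENNReal.ofReal C * (‖f k x - g x‖ₑ * (‖f k x‖ₑ + ‖g x‖ₑ)) ∂μ := lintegral_mono hpt
    _ = ENNReal.ofReal C * ∫⁻ x, ‖f k x - g x‖ₑ * (‖f k x‖ₑ + ‖g x‖ₑ) ∂μ :=
        lintegral_const_mul'' _ (hF.mul hG)
    _ ≤ ENNReal.ofReal C * ((∫⁻ x, ‖f k x - g x‖ₑ ^ (2 : ℝ) ∂μ) ^ (1 / (2 : ℝ)) *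
          (∫⁻ x, (‖f k x‖ₑ + ‖g x‖ₑ) ^ (2 : ℝ) ∂μ) ^ (1 / (2 : ℝ))) := by
        gcongr
        exact ENNReal.lintegral_mul_le_Lp_mul_Lq μ Real.HolderConjugate.two_two hF hG
    _ ≤ ENNReal.ofReal C *
          (eLpNorm (f k - g) 2 μ * (eLpNorm (f k - g) 2 μ + 2 * eLpNorm g 2 μ)) := by
        gcongr ENNReal.ofReal C * (?_ * ?_)
        · exact (FunctionSpaces.lintegral_rpow_two_eq_eLpNorm (f k - g)).le
        · have h1 : (∫⁻ x, (‖f k x‖ₑ + ‖g x‖ₑ) ^ (2 : ℝ) ∂μ) ^ (1 / (2 : ℝ)) =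
              eLpNorm (fun x => ‖f k x‖ + ‖g x‖) 2 μ := by
            rw [← FunctionSpaces.lintegral_rpow_two_eq_eLpNorm]
            congr 1
            refine lintegral_congr fun x => ?_
            rw [Real.enorm_of_nonneg (add_nonneg (norm_nonneg _) (norm_nonneg _)),
              ENNReal.ofReal_add (norm_nonneg _) (norm_nonneg _), ofReal_norm, ofReal_norm]
          rw [h1]
          calc eLpNorm (fun x => ‖f k x‖ + ‖g x‖) 2 μ
              ≤ eLpNorm (fun x => ‖f k x‖) 2 μ + eLpNorm (fun x => ‖g x‖) 2 μ :=
                eLpNorm_add_le (hf k).1.norm hg.1.norm one_le_two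
            _ = eLpNorm (f k) 2 μ + eLpNorm g 2 μ := by rw [eLpNorm_norm, eLpNorm_norm]
            _ ≤ (eLpNorm (f k - g) 2 μ + eLpNorm g 2 μ) + eLpNorm g 2 μ := by
                gcongr
                have h := eLpNorm_add_le ((hf k).1.sub hg.1) hg.1 one_le_two (μ := μ)
                simpa using h
            _ = eLpNorm (f k - g) 2 μ + 2 * eLpNorm g 2 μ := by ring
    _ = d k := rfl

/-- `‖ ‖h‖² ‖_{L^{3/2}} ≤ ‖h‖²_{L³}` (Hölder `L³ · L³ ⊂ L^{3/2}`). [folklore] -/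
theorem eLpNorm_norm_sq_threeHalves_le {F : Type*} [NormedAddCommGroup F] {h : X → F}
    (hh : AEStronglyMeasurable h μ) :
    eLpNorm (fun x => ‖h x‖ ^ 2) (3 / 2) μ ≤ eLpNorm h 3 μ * eLpNorm h 3 μ := by
  have h1 := FunctionSpaces.eLpNorm_mul_threeHalves_le (μ := μ) hh.norm hh.norm
  simp_rw [← pow_two] at h1
  rwa [eLpNorm_norm, pow_two] at h1

/-- **Cubic pairings pass to `L³` limits**: if `fₖ, g ∈ L³(μ)`, `‖fₖ - g‖_{L³} → 0` and `w` is a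
bounded measurable field, then `∫ ‖fₖ‖² ⟪fₖ, w⟫ → ∫ ‖g‖² ⟪g, w⟫` (the transport term
`∫ |u|² u·∇φ` of the local energy inequality; `‖fₖ‖² → ‖g‖²` in `L^{3/2}`, `⟪fₖ, w⟫ → ⟪g, w⟫` in
`L³`, and Hölder `(3/2, 3, 1)`, `Literature.Analysis.FunctionSpaces.tendsto_integral_mul_mul`). [folklore] -/
theorem tendsto_integral_norm_sq_mul_inner {f : ℕ → X → E} {g : X → E}
    (hf : ∀ k, MemLp (f k) 3 μ) (hg : MemLp g 3 μ)
    (hlim : Tendsto (fun k => eLpNorm (f k - g) 3 μ) atTop (𝓝 0)) {w : X → E}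
    (hw : AEStronglyMeasurable w μ) {C : ℝ} (hC : ∀ x, ‖w x‖ ≤ C) :
    Tendsto (fun k => ∫ x, ‖f k x‖ ^ 2 * ⟪f k x, w x⟫ ∂μ) atTop
      (𝓝 (∫ x, ‖g x‖ ^ 2 * ⟪g x, w x⟫ ∂μ)) := by
  have h3 : (1 : ℝ≥0∞) ≤ 3 := by norm_num
  -- the two factors and their convergence
  have hAm : ∀ k, AEStronglyMeasurable (fun x => ‖f k x‖ ^ 2) μ := fun k =>
    ((hf k).1.norm.aemeasurable.pow_const 2).aestronglyMeasurable
  have hA'm : AEStronglyMeasurable (fun x => ‖g x‖ ^ 2) μ :=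
    (hg.1.norm.aemeasurable.pow_const 2).aestronglyMeasurable
  have hBm : ∀ k, AEStronglyMeasurable (fun x => ⟪f k x, w x⟫) μ := fun k => (hf k).1.inner hw
  have hB'm : AEStronglyMeasurable (fun x => ⟪g x, w x⟫) μ := hg.1.inner hw
  have hA' : eLpNorm (fun x => ‖g x‖ ^ 2) (3 / 2) μ < ⊤ :=
    (eLpNorm_norm_sq_threeHalves_le hg.1).trans_lt (ENNReal.mul_lt_top hg.2 hg.2)
  have hBw : ∀ {h : X → E}, AEStronglyMeasurable h μ →
      eLpNorm (fun x => ⟪h x, w x⟫) 3 μ ≤ ENNReal.ofReal C * eLpNorm h 3 μ := fun {h} hh => by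
    refine eLpNorm_le_mul_eLpNorm_of_ae_le_mul (Eventually.of_forall fun x => ?_) 3
    rw [mul_comm]
    exact (norm_inner_le_norm _ _).trans (mul_le_mul_of_nonneg_left (hC x) (norm_nonneg _))
  have hB' : eLpNorm (fun x => ⟪g x, w x⟫) 3 μ < ⊤ :=
    (hBw hg.1).trans_lt (ENNReal.mul_lt_top ENNReal.ofReal_lt_top hg.2)
  have hA : Tendsto (fun k => eLpNorm ((fun x => ‖f k x‖ ^ 2) - fun x => ‖g x‖ ^ 2) (3 / 2) μ)
      atTop (𝓝 0) := by
    -- `‖fₖ‖² - ‖g‖² = (‖fₖ‖ - ‖g‖)(‖fₖ‖ + ‖g‖)`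
    have hbd : ∀ k, eLpNorm ((fun x => ‖f k x‖ ^ 2) - fun x => ‖g x‖ ^ 2) (3 / 2) μ ≤
        eLpNorm (f k - g) 3 μ * (eLpNorm (f k - g) 3 μ + 2 * eLpNorm g 3 μ) := by
      intro k
      have e : ((fun x => ‖f k x‖ ^ 2) - fun x => ‖g x‖ ^ 2) =
          fun x => (‖f k x‖ - ‖g x‖) * (‖f k x‖ + ‖g x‖) := by
        funext x; simp only [Pi.sub_apply]; ring
      rw [e]
      refine (FunctionSpaces.eLpNorm_mul_threeHalves_le ((hf k).1.norm.sub hg.1.norm)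
        ((hf k).1.norm.add hg.1.norm)).trans ?_
      gcongr
      · refine (eLpNorm_mono fun x => ?_)
        rw [Real.norm_eq_abs]
        exact abs_norm_sub_norm_le (f k x) (g x)
      · calc eLpNorm (fun x => ‖f k x‖ + ‖g x‖) 3 μ
            ≤ eLpNorm (fun x => ‖f k x‖) 3 μ + eLpNorm (fun x => ‖g x‖) 3 μ :=
              eLpNorm_add_le (hf k).1.norm hg.1.norm h3
          _ = eLpNorm (f k) 3 μ + eLpNorm g 3 μ := by rw [eLpNorm_norm, eLpNorm_norm]
          _ ≤ (eLpNorm (f k - g) 3 μ + eLpNorm g 3 μ) + eLpNorm g 3 μ := by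
              gcongr
              have h := eLpNorm_add_le ((hf k).1.sub hg.1) hg.1 h3 (μ := μ)
              simpa using h
          _ = eLpNorm (f k - g) 3 μ + 2 * eLpNorm g 3 μ := by ring
    have hG2 : 2 * eLpNorm g 3 μ ≠ ⊤ := ENNReal.mul_ne_top ENNReal.ofNat_ne_top hg.2.ne
    have h1 : Tendsto (fun k => eLpNorm (f k - g) 3 μ + 2 * eLpNorm g 3 μ) atTop
        (𝓝 (0 + 2 * eLpNorm g 3 μ)) := hlim.add tendsto_const_nhds
    have h2 := ENNReal.Tendsto.mul hlim (Or.inr (by simpa using hG2)) h1 (Or.inr ENNReal.zero_ne_top)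
    rw [zero_mul] at h2
    exact tendsto_of_tendsto_of_tendsto_of_le_of_le tendsto_const_nhds h2 (fun k => zero_le) hbd
  have hB : Tendsto (fun k => eLpNorm ((fun x => ⟪f k x, w x⟫) - fun x => ⟪g x, w x⟫) 3 μ)
      atTop (𝓝 0) := by
    have hbd : ∀ k, eLpNorm ((fun x => ⟪f k x, w x⟫) - fun x => ⟪g x, w x⟫) 3 μ ≤
        ENNReal.ofReal C * eLpNorm (f k - g) 3 μ := by
      intro k
      have e : ((fun x => ⟪f k x, w x⟫) - fun x => ⟪g x, w x⟫) = fun x => ⟪(f k - g) x, w x⟫ := by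
        funext x; simp only [Pi.sub_apply, inner_sub_left]
      rw [e]
      exact hBw ((hf k).1.sub hg.1)
    have h2 := ENNReal.Tendsto.const_mul (a := ENNReal.ofReal C) hlim (Or.inr ENNReal.ofReal_ne_top)
    rw [mul_zero] at h2
    exact tendsto_of_tendsto_of_tendsto_of_le_of_le tendsto_const_nhds h2 (fun k => zero_le) hbd
  have key := FunctionSpaces.tendsto_integral_mul_mul hAm hA'm hBm hB'm hA' hB' hA hB
    (c := fun _ => (1 : ℝ)) aestronglyMeasurable_const (C := 1) (fun _ => by simp)
  simpa only [one_mul] using key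

/-- **Weak–strong products pass to the limit**: if `πₖ ⇀ p` weakly in `L^{3/2}(μ)` (pairings
against `L³(μ)` converge) with `‖πₖ‖_{L^{3/2}} ≤ M < ∞`, and `fₖ → g` in `L³(μ; E)`, then
`∫ πₖ ⟪fₖ, w⟫ → ∫ p ⟪g, w⟫` for every bounded measurable field `w` (the pressure term
`∫ p u·∇φ` of the local energy inequality). [folklore] -/
theorem tendsto_integral_mul_inner_of_weak_strong {π : ℕ → X → ℝ} {p : X → ℝ}
    {f : ℕ → X → E} {g : X → E} {M : ℝ≥0∞} (hM : M ≠ ⊤)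
    (hπm : ∀ k, AEStronglyMeasurable (π k) μ) (hπM : ∀ k, eLpNorm (π k) (3 / 2) μ ≤ M)
    (hweak : ∀ ψ : X → ℝ, MemLp ψ 3 μ →
      Tendsto (fun k => ∫ x, π k x * ψ x ∂μ) atTop (𝓝 (∫ x, p x * ψ x ∂μ)))
    (hf : ∀ k, MemLp (f k) 3 μ) (hg : MemLp g 3 μ)
    (hlim : Tendsto (fun k => eLpNorm (f k - g) 3 μ) atTop (𝓝 0)) {w : X → E}
    (hw : AEStronglyMeasurable w μ) {C : ℝ} (hC : ∀ x, ‖w x‖ ≤ C) :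
    Tendsto (fun k => ∫ x, π k x * ⟪f k x, w x⟫ ∂μ) atTop (𝓝 (∫ x, p x * ⟪g x, w x⟫ ∂μ)) := by
  have h3 : (1 : ℝ≥0∞) ≤ 3 := by norm_num
  have hT := FunctionSpaces.holderTriple_threeHalves_three
  -- `⟪h, w⟫ ∈ L³` with `‖⟪h, w⟫‖₃ ≤ C ‖h‖₃`
  have hBw : ∀ {h : X → E}, AEStronglyMeasurable h μ →
      eLpNorm (fun x => ⟪h x, w x⟫) 3 μ ≤ ENNReal.ofReal C * eLpNorm h 3 μ := fun {h} hh => by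
    refine eLpNorm_le_mul_eLpNorm_of_ae_le_mul (Eventually.of_forall fun x => ?_) 3
    rw [mul_comm]
    exact (norm_inner_le_norm _ _).trans (mul_le_mul_of_nonneg_left (hC x) (norm_nonneg _))
  have hBmem : ∀ {h : X → E}, MemLp h 3 μ → MemLp (fun x => ⟪h x, w x⟫) 3 μ := fun {h} hh =>
    ⟨hh.1.inner hw, (hBw hh.1).trans_lt (ENNReal.mul_lt_top ENNReal.ofReal_lt_top hh.2)⟩
  have hπmem : ∀ k, MemLp (π k) (3 / 2) μ := fun k => ⟨hπm k, (hπM k).trans_lt hM.lt_top⟩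
  -- the pairings with the fixed `⟪g, w⟫` converge by weak convergence
  have h1 := hweak _ (hBmem hg)
  -- the remainder `∫ πₖ ⟪fₖ - g, w⟫ → 0`
  have hint : ∀ k {h : X → E}, MemLp h 3 μ → Integrable (fun x => π k x * ⟪h x, w x⟫) μ :=
    fun k {h} hh => by
      have := (hBmem hh).integrable_mul (hπmem k)
      refine this.congr (Eventually.of_forall fun x => ?_)
      simp only [Pi.mul_apply, mul_comm]
  have h2 : Tendsto (fun k => (∫ x, π k x * ⟪f k x, w x⟫ ∂μ) - ∫ x, π k x * ⟪g x, w x⟫ ∂μ)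
      atTop (𝓝 0) := by
    set d : ℕ → ℝ≥0∞ := fun k => M * (ENNReal.ofReal C * eLpNorm (f k - g) 3 μ) with hd
    have hdt : Tendsto d atTop (𝓝 0) := by
      have h2 := ENNReal.Tendsto.const_mul (a := ENNReal.ofReal C) hlim (Or.inr ENNReal.ofReal_ne_top)
      rw [mul_zero] at h2
      have h3' := ENNReal.Tendsto.const_mul (a := M) h2 (Or.inr hM)
      rw [mul_zero] at h3'
      exact h3'
    have hdr : Tendsto (fun k => (d k).toReal) atTop (𝓝 0) := by
      have h := (ENNReal.tendsto_toReal ENNReal.zero_ne_top).comp hdt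
      rwa [ENNReal.toReal_zero] at h
    have hdtop : ∀ k, d k ≠ ⊤ := fun k => ENNReal.mul_ne_top hM
      (ENNReal.mul_ne_top ENNReal.ofReal_ne_top ((hf k).sub hg).eLpNorm_ne_top)
    refine squeeze_zero_norm (fun k => ?_) hdr
    rw [Real.norm_eq_abs, ← integral_sub (hint k (hf k)) (hint k hg)]
    refine abs_integral_le_toReal_of_lintegral_le (hdtop k) ?_
    have e : ∀ x, π k x * ⟪f k x, w x⟫ - π k x * ⟪g x, w x⟫ = π k x * ⟪(f k - g) x, w x⟫ :=
      fun x => by simp only [Pi.sub_apply, inner_sub_left]; ring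
    simp_rw [e]
    calc ∫⁻ x, ‖π k x * ⟪(f k - g) x, w x⟫‖ₑ ∂μ
        ≤ eLpNorm (π k) (3 / 2) μ * eLpNorm (fun x => ⟪(f k - g) x, w x⟫) 3 μ :=
          FunctionSpaces.lintegral_enorm_mul_le_threeHalves_three (hπm k)
            (((hf k).1.sub hg.1).inner hw)
      _ ≤ M * (ENNReal.ofReal C * eLpNorm (f k - g) 3 μ) :=
          mul_le_mul' (hπM k) (hBw ((hf k).1.sub hg.1))
      _ = d k := rfl
  have h := h1.add h2
  rw [add_zero] at h
  refine h.congr fun k => ?_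
  ring

end Pairings

/-! ### Space–time bookkeeping: iterated integrals, weights of test functions -/

section SpaceTime

variable {E : Type*} [NormedAddCommGroup E] [InnerProductSpace ℝ E] [FiniteDimensional ℝ E]
  [MeasurableSpace E] [BorelSpace E]

/-- **Iterated integrals of integrands supported in `Q` are set integrals over `Q`**: if `H` is
integrable on `Q` and vanishes off `Q`, then `∫ dt ∫ dx H(t, x) = ∫_Q H` (Fubini on `ℝ × E`).
This converts the iterated integrals of `IsSuitableWeakSolutionOn` / `HasWeakSpatialGradientOn`
into integrals for the restricted product measure. [folklore] -/
theorem integral_integral_eq_setIntegral {F : Type*} [NormedAddCommGroup F] [NormedSpace ℝ F]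
    {S : Set (ℝ × E)} {H : ℝ × E → F} (hH : IntegrableOn H S volume)
    (h0 : ∀ z, z ∉ S → H z = 0) :
    ∫ t, ∫ x, H (t, x) = ∫ z in S, H z := by
  have hsupp : support H ⊆ S := fun z hz => by_contra fun h => hz (h0 z h)
  have hH' : Integrable H (volume : Measure (ℝ × E)) :=
    (integrableOn_iff_integrable_of_support_subset hsupp).1 hH
  rw [setIntegral_eq_integral_of_forall_compl_eq_zero fun z hz => h0 z hz]
  have hH'' : Integrable H ((volume : Measure ℝ).prod (volume : Measure E)) := by
    rwa [← Measure.volume_eq_prod]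
  rw [Measure.volume_eq_prod, integral_prod H hH'']

omit [MeasurableSpace E] [BorelSpace E] in
/-- A continuous function vanishing off a compact set is bounded, by a nonnegative constant.
[folklore] -/
theorem exists_nonneg_bound_of_eq_zero_off_compact {Y F : Type*} [TopologicalSpace Y]
    [NormedAddCommGroup F] {K : Set Y} (hK : IsCompact K) {g : Y → F} (hg : Continuous g)
    (h0 : ∀ y, y ∉ K → g y = 0) : ∃ C : ℝ, 0 ≤ C ∧ ∀ y, ‖g y‖ ≤ C := by
  obtain ⟨C, hC⟩ := (hK.image hg).isBounded.exists_norm_le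
  refine ⟨max C 0, le_max_right _ _, fun y => ?_⟩
  by_cases hy : y ∈ K
  · exact (hC _ ⟨y, hy, rfl⟩).trans (le_max_left _ _)
  · rw [h0 y hy, norm_zero]; exact le_max_right _ _

omit [MeasurableSpace E] [BorelSpace E] in
/-- The weights built from a vector test field — `∂ₜψ`, `Dψ`, `Δψ`, `div ψ`, `ψ` — vanish off
its space–time support (the field vanishes on a neighbourhood of every such point). [folklore] -/
theorem testField_weights_eq_zero_of_notMem_tsupport {ψ : ℝ → E → E} {z : ℝ × E}
    (hz : z ∉ tsupport (uncurry ψ)) :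
    timeDeriv ψ z.1 z.2 = 0 ∧ fderiv ℝ (ψ z.1) z.2 = 0 ∧ Δ (ψ z.1) z.2 = 0 ∧
      VectorCalculus.divergence (ψ z.1) z.2 = 0 ∧ ψ z.1 z.2 = 0 := by
  have h0 : uncurry ψ =ᶠ[𝓝 (z.1, z.2)] 0 := notMem_tsupport_iff_eventuallyEq.1 hz
  have hc1 : Continuous fun s : ℝ => (s, z.2) := continuous_id.prodMk continuous_const
  have hc2 : Continuous fun y : E => (z.1, y) := continuous_const.prodMk continuous_id
  have h1 : (fun s => ψ s z.2) =ᶠ[𝓝 z.1] fun _ => (0 : E) := (hc1.tendsto z.1).eventually h0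
  have h2 : ψ z.1 =ᶠ[𝓝 z.2] fun _ => (0 : E) := (hc2.tendsto z.2).eventually h0
  have hD : fderiv ℝ (ψ z.1) z.2 = 0 := by rw [h2.fderiv_eq, fderiv_fun_const, Pi.zero_apply]
  refine ⟨?_, hD, ?_, ?_, ?_⟩
  · rw [timeDeriv_apply, h1.deriv_eq, deriv_const]
  · rw [(InnerProductSpace.laplacian_congr_nhds h2).self_of_nhds, InnerProductSpace.laplacian_const,
      Pi.zero_apply]
  · simp [VectorCalculus.divergence, hD]
  · exact (image_eq_zero_of_notMem_tsupport hz : uncurry ψ z = 0)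

omit [MeasurableSpace E] [BorelSpace E] in
/-- Bounds for the weights of a vector space–time test field: `‖∂ₜψ‖, ‖Dψ‖, ‖Δψ‖, |div ψ| ≤ C`
everywhere. [folklore] -/
theorem IsSpaceTimeTestOn.exists_weights_bound {Q : Opens (ℝ × E)} {ψ : ℝ → E → E}
    (hψ : IsSpaceTimeTestOn Q ψ) :
    ∃ C : ℝ, 0 ≤ C ∧ (∀ z : ℝ × E, ‖timeDeriv ψ z.1 z.2‖ ≤ C) ∧
      (∀ z : ℝ × E, ‖fderiv ℝ (ψ z.1) z.2‖ ≤ C) ∧ (∀ z : ℝ × E, ‖Δ (ψ z.1) z.2‖ ≤ C) ∧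
      ∀ z : ℝ × E, ‖VectorCalculus.divergence (ψ z.1) z.2‖ ≤ C := by
  have hK : IsCompact (tsupport (uncurry ψ)) := hψ.hasCompactSupport
  obtain ⟨C₁, h₁0, h₁⟩ := exists_nonneg_bound_of_eq_zero_off_compact hK
    (g := fun z : ℝ × E => timeDeriv ψ z.1 z.2) hψ.continuous_timeDeriv
    fun z hz => (testField_weights_eq_zero_of_notMem_tsupport hz).1
  obtain ⟨C₂, h₂0, h₂⟩ := exists_nonneg_bound_of_eq_zero_off_compact hK
    (g := fun z : ℝ × E => fderiv ℝ (ψ z.1) z.2) hψ.continuous_fderiv_slice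
    fun z hz => (testField_weights_eq_zero_of_notMem_tsupport hz).2.1
  obtain ⟨C₃, h₃0, h₃⟩ := exists_nonneg_bound_of_eq_zero_off_compact hK
    (g := fun z : ℝ × E => Δ (ψ z.1) z.2) hψ.continuous_laplacian_slice
    fun z hz => (testField_weights_eq_zero_of_notMem_tsupport hz).2.2.1
  obtain ⟨C₄, h₄0, h₄⟩ := exists_nonneg_bound_of_eq_zero_off_compact hK
    (g := fun z : ℝ × E => VectorCalculus.divergence (ψ z.1) z.2) hψ.continuous_divergence_slice
    fun z hz => (testField_weights_eq_zero_of_notMem_tsupport hz).2.2.2.1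
  refine ⟨max (max C₁ C₂) (max C₃ C₄), by positivity, fun z => (h₁ z).trans ?_,
    fun z => (h₂ z).trans ?_, fun z => (h₃ z).trans ?_, fun z => (h₄ z).trans ?_⟩
  · exact (le_max_left _ _).trans (le_max_left _ _)
  · exact (le_max_right _ _).trans (le_max_left _ _)
  · exact (le_max_left _ _).trans (le_max_right _ _)
  · exact (le_max_right _ _).trans (le_max_right _ _)

omit [MeasurableSpace E] [BorelSpace E] in
/-- Bounds for the weights of a scalar space–time test function: `|φ|, |∂ₜφ|, ‖∇φ‖, |Δφ| ≤ C`
everywhere. [folklore] -/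
theorem IsSpaceTimeTestOn.exists_scalar_weights_bound {Q : Opens (ℝ × E)} {φ : ℝ → E → ℝ}
    (hφ : IsSpaceTimeTestOn Q φ) :
    ∃ C : ℝ, 0 ≤ C ∧ (∀ z : ℝ × E, ‖φ z.1 z.2‖ ≤ C) ∧ (∀ z : ℝ × E, ‖timeDeriv φ z.1 z.2‖ ≤ C) ∧
      (∀ z : ℝ × E, ‖gradient (φ z.1) z.2‖ ≤ C) ∧ ∀ z : ℝ × E, ‖Δ (φ z.1) z.2‖ ≤ C := by
  have hK : IsCompact (tsupport (uncurry φ)) := hφ.hasCompactSupport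
  obtain ⟨C₁, h₁0, h₁⟩ := exists_nonneg_bound_of_eq_zero_off_compact hK
    (g := uncurry φ) hφ.contDiff.continuous fun z hz => image_eq_zero_of_notMem_tsupport hz
  obtain ⟨C₂, h₂0, h₂⟩ := exists_nonneg_bound_of_eq_zero_off_compact hK
    (g := fun z : ℝ × E => timeDeriv φ z.1 z.2) hφ.continuous_timeDeriv
    fun z hz => (weights_eq_zero_of_notMem_tsupport hz).2.2.2
  obtain ⟨C₃, h₃0, h₃⟩ := exists_nonneg_bound_of_eq_zero_off_compact hK
    (g := fun z : ℝ × E => gradient (φ z.1) z.2) hφ.continuous_slice_gradient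
    fun z hz => (weights_eq_zero_of_notMem_tsupport hz).2.1
  obtain ⟨C₄, h₄0, h₄⟩ := exists_nonneg_bound_of_eq_zero_off_compact hK
    (g := fun z : ℝ × E => Δ (φ z.1) z.2) hφ.continuous_laplacian_slice
    fun z hz => (weights_eq_zero_of_notMem_tsupport hz).2.2.1
  refine ⟨max (max C₁ C₂) (max C₃ C₄), by positivity, fun z => (h₁ z).trans ?_,
    fun z => (h₂ z).trans ?_, fun z => (h₃ z).trans ?_, fun z => (h₄ z).trans ?_⟩
  · exact (le_max_left _ _).trans (le_max_left _ _)
  · exact (le_max_right _ _).trans (le_max_left _ _)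
  · exact (le_max_left _ _).trans (le_max_right _ _)
  · exact (le_max_right _ _).trans (le_max_right _ _)

end SpaceTime

/-! ### Weak lower semicontinuity of the weighted dissipation -/

section LowerSemicontinuity

variable {E : Type*} [NormedAddCommGroup E] [InnerProductSpace ℝ E] [FiniteDimensional ℝ E]

/-- `ofReal (|L|²_F φ) = ∑ᵢ ‖√φ • L bᵢ‖ₑ²` for `φ ≥ 0` (`b` the standard orthonormal frame).
[folklore] -/
theorem ofReal_frobeniusNormSq_mul_eq_sum (L : E →L[ℝ] E) {r : ℝ} (hr : 0 ≤ r) :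
    ENNReal.ofReal (frobeniusNormSq L * r) =
      ∑ i, ‖Real.sqrt r • L (stdOrthonormalBasis ℝ E i)‖ₑ ^ 2 := by
  have e : frobeniusNormSq L * r = ∑ i, ‖Real.sqrt r • L (stdOrthonormalBasis ℝ E i)‖ ^ 2 := by
    rw [frobeniusNormSq, Finset.sum_mul]
    refine Finset.sum_congr rfl fun i _ => ?_
    rw [norm_smul, mul_pow, Real.norm_eq_abs, sq_abs, Real.sq_sqrt hr]
    ring
  rw [e, ENNReal.ofReal_sum_of_nonneg fun i _ => sq_nonneg _]
  refine Finset.sum_congr rfl fun i _ => ?_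
  rw [← ofReal_norm, ENNReal.ofReal_pow (norm_nonneg _)]

omit [FiniteDimensional ℝ E] in
/-- `⟪√r • x, √r • y⟫ = ⟪x, r • y⟫` for `r ≥ 0`. [folklore] -/
theorem inner_sqrt_smul_sqrt_smul (x y : E) {r : ℝ} (hr : 0 ≤ r) :
    ⟪Real.sqrt r • x, Real.sqrt r • y⟫ = ⟪x, r • y⟫ := by
  rw [real_inner_smul_left, real_inner_smul_right, real_inner_smul_right, ← mul_assoc,
    Real.mul_self_sqrt hr]

/-- **Weak lower semicontinuity of the weighted dissipation `∫ |G|² φ`.** On a measure space, let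
operator fields `Gₖ` converge to `G` weakly in `L²` column by column (`∫ ⟪Gₖ a, h⟫ → ∫ ⟪G a, h⟫`
for every direction `a` and every `h ∈ L²`), with `∫ |G|²_F < ∞`, and let `0 ≤ φ ≤ C` be a
measurable weight. If eventually `∫ |Gₖ|²_F φ ≤ B`, then `∫ |G|²_F φ ≤ B` (Brezis 2011, Prop. 3.5
(iii), applied in `⊕ᵢ L²` to the fields `√φ • Gₖ bᵢ ⇀ √φ • G bᵢ`; this is the "left hand-sides
are lower semi-continuous (cf. [CKN])" of Bradshaw–Tsai 2019, §4.3). [cite: Brezis2011, Prop. 3.5 (iii)] -/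
theorem lintegral_frobeniusNormSq_mul_le_of_tendsto {X : Type*} [MeasurableSpace X] {μ : Measure X}
    {G : ℕ → X → E →L[ℝ] E} {Gu : X → E →L[ℝ] E} {φ : X → ℝ} {C : ℝ}
    (hGm : ∀ k, AEStronglyMeasurable (G k) μ) (hGum : AEStronglyMeasurable Gu μ)
    (hGu2 : ∫⁻ x, ENNReal.ofReal (frobeniusNormSq (Gu x)) ∂μ < ∞)
    (hφm : AEStronglyMeasurable φ μ) (hφ0 : ∀ x, 0 ≤ φ x) (hφC : ∀ x, φ x ≤ C)
    (hGw : ∀ (a : E) (h : X → E), MemLp h 2 μ →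
      Tendsto (fun k => ∫ x, ⟪G k x a, h x⟫ ∂μ) atTop (𝓝 (∫ x, ⟪Gu x a, h x⟫ ∂μ)))
    {B : ℝ≥0∞} (hB : ∀ᶠ k in atTop, ∫⁻ x, ENNReal.ofReal (frobeniusNormSq (G k x) * φ x) ∂μ ≤ B) :
    ∫⁻ x, ENNReal.ofReal (frobeniusNormSq (Gu x) * φ x) ∂μ ≤ B := by
  obtain ⟨N, hN⟩ := eventually_atTop.1 hB
  set b := stdOrthonormalBasis ℝ E with hb
  have hC0 : ∀ x, 0 ≤ C := fun x => (hφ0 x).trans (hφC x)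
  -- the columns and the weighted columns
  have hcol : ∀ {H : X → E →L[ℝ] E}, AEStronglyMeasurable H μ → ∀ a : E,
      AEStronglyMeasurable (fun x => H x a) μ := fun {H} hH a =>
    (ContinuousLinearMap.apply ℝ E a).continuous.comp_aestronglyMeasurable hH
  have hsqrt : AEStronglyMeasurable (fun x => Real.sqrt (φ x)) μ :=
    Real.continuous_sqrt.comp_aestronglyMeasurable hφm
  set f : ℕ → Fin (Module.finrank ℝ E) → X → E := fun k i x => Real.sqrt (φ x) • G (k + N) x (b i)
    with hf
  set g : Fin (Module.finrank ℝ E) → X → E := fun i x => Real.sqrt (φ x) • Gu x (b i) with hg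
  have hfm : ∀ k i, AEStronglyMeasurable (f k i) μ := fun k i => hsqrt.smul (hcol (hGm _) _)
  -- `|Gu|²` is integrable, hence the weighted columns are in `L²`
  have hfrobm : ∀ {H : X → E →L[ℝ] E}, AEStronglyMeasurable H μ →
      AEStronglyMeasurable (fun x => frobeniusNormSq (H x)) μ := fun {H} hH =>
    LerayHopfProofs.continuous_frobeniusNormSq.comp_aestronglyMeasurable hH
  have hGuI : Integrable (fun x => frobeniusNormSq (Gu x)) μ := by
    refine ⟨hfrobm hGum, ?_⟩
    rw [hasFiniteIntegral_iff_enorm]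
    refine lt_of_le_of_lt (lintegral_mono fun x => ?_) hGu2
    rw [Real.enorm_eq_ofReal (frobeniusNormSq_nonneg _)]
  have hnorm_col : ∀ (L : E →L[ℝ] E) (i : Fin (Module.finrank ℝ E)),
      ‖L (b i)‖ ^ 2 ≤ frobeniusNormSq L := fun L i => by
    rw [frobeniusNormSq]
    exact Finset.single_le_sum (f := fun j => ‖L (b j)‖ ^ 2) (fun j _ => sq_nonneg _)
      (Finset.mem_univ i)
  have hg2 : ∀ i, MemLp (g i) 2 μ := by
    intro i
    have hgm : AEStronglyMeasurable (g i) μ := hsqrt.smul (hcol hGum _)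
    refine (memLp_two_iff_integrable_sq_norm hgm).2 ?_
    refine (hGuI.const_mul C).mono' (hgm.norm.pow 2) (Eventually.of_forall fun x => ?_)
    rw [Real.norm_eq_abs, abs_of_nonneg (sq_nonneg _), hg]
    dsimp only
    rw [norm_smul, mul_pow, Real.norm_eq_abs, sq_abs, Real.sq_sqrt (hφ0 x)]
    calc φ x * ‖Gu x (b i)‖ ^ 2 ≤ C * frobeniusNormSq (Gu x) :=
          mul_le_mul (hφC x) (hnorm_col _ _) (sq_nonneg _) (hC0 x)
      _ = C * frobeniusNormSq (Gu x) := rfl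
  have hGucol2 : ∀ i, MemLp (fun x => φ x • Gu x (b i)) 2 μ := by
    intro i
    have hm : AEStronglyMeasurable (fun x => φ x • Gu x (b i)) μ := hφm.smul (hcol hGum _)
    refine (memLp_two_iff_integrable_sq_norm hm).2 ?_
    refine (hGuI.const_mul (C ^ 2)).mono' (hm.norm.pow 2) (Eventually.of_forall fun x => ?_)
    rw [Real.norm_eq_abs, abs_of_nonneg (sq_nonneg _), norm_smul, mul_pow, Real.norm_eq_abs,
      sq_abs]
    exact mul_le_mul (pow_le_pow_left₀ (hφ0 x) (hφC x) 2) (hnorm_col _ _) (sq_nonneg _)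
      (sq_nonneg _)
  -- weak convergence of the weighted columns, tested against the limit
  have hlim : Tendsto (fun k => ∑ i, ∫ x, ⟪f k i x, g i x⟫ ∂μ) atTop
      (𝓝 (∑ i, ∫ x, ⟪g i x, g i x⟫ ∂μ)) := by
    refine tendsto_finsetSum _ fun i _ => ?_
    have e1 : ∀ k, ∫ x, ⟪f k i x, g i x⟫ ∂μ = ∫ x, ⟪G (k + N) x (b i), φ x • Gu x (b i)⟫ ∂μ :=
      fun k => integral_congr_ae (Eventually.of_forall fun x => inner_sqrt_smul_sqrt_smul _ _ (hφ0 x))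
    have e2 : ∫ x, ⟪g i x, g i x⟫ ∂μ = ∫ x, ⟪Gu x (b i), φ x • Gu x (b i)⟫ ∂μ :=
      integral_congr_ae (Eventually.of_forall fun x => inner_sqrt_smul_sqrt_smul _ _ (hφ0 x))
    simp only [e1, e2]
    exact (hGw (b i) _ (hGucol2 i)).comp (tendsto_add_atTop_nat N)
  -- the uniform bound along the tail
  have hsum : ∀ (H : X → E →L[ℝ] E), AEStronglyMeasurable H μ →
      ∑ i, ∫⁻ x, ‖Real.sqrt (φ x) • H x (b i)‖ₑ ^ 2 ∂μ =
        ∫⁻ x, ENNReal.ofReal (frobeniusNormSq (H x) * φ x) ∂μ := by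
    intro H hH
    have hm : ∀ i, AEMeasurable (fun x => ‖Real.sqrt (φ x) • H x (b i)‖ₑ ^ 2) μ := fun i =>
      (hsqrt.smul (hcol hH (b i))).enorm.pow_const 2
    rw [← lintegral_finsetSum' _ fun i _ => hm i]
    exact lintegral_congr fun x => (ofReal_frobeniusNormSq_mul_eq_sum (H x) (hφ0 x)).symm
  have hBk : ∀ k, ∑ i, ∫⁻ x, ‖f k i x‖ₑ ^ 2 ∂μ ≤ B := fun k => by
    rw [hf]
    dsimp only
    rw [hsum _ (hGm _)]
    exact hN _ (Nat.le_add_left N k)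
  have key := FunctionSpaces.sum_lintegral_enorm_sq_le_of_tendsto_integral_inner hfm hg2 hlim hBk
  rwa [hg, hsum _ hGum] at key

end LowerSemicontinuity

/-! ### The local energy inequality in set-integral form, and the limit of its right-hand side -/

section LocalEnergy

variable {E : Type*} [NormedAddCommGroup E] [InnerProductSpace ℝ E] [FiniteDimensional ℝ E]
  [MeasurableSpace E] [BorelSpace E]

/-- `L³`-convergence on a finite measure space implies `L²`-convergence. [folklore] -/
theorem tendsto_eLpNorm_two_of_three {X : Type*} [MeasurableSpace X] {μ : Measure X}
    [IsFiniteMeasure μ] {F : Type*} [NormedAddCommGroup F] {f : ℕ → X → F}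
    (hf : ∀ k, AEStronglyMeasurable (f k) μ)
    (h : Tendsto (fun k => eLpNorm (f k) 3 μ) atTop (𝓝 0)) :
    Tendsto (fun k => eLpNorm (f k) 2 μ) atTop (𝓝 0) := by
  have h23 : (2 : ℝ≥0∞) ≤ 3 := by norm_num
  set c : ℝ≥0∞ := μ univ ^ (1 / (2 : ℝ≥0∞).toReal - 1 / (3 : ℝ≥0∞).toReal) with hc
  have hct : c ≠ ⊤ := ENNReal.rpow_ne_top_of_nonneg (by norm_num) (measure_ne_top _ _)
  have hbd : ∀ k, eLpNorm (f k) 2 μ ≤ eLpNorm (f k) 3 μ * c := fun k =>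
    eLpNorm_le_eLpNorm_mul_rpow_measure_univ h23 (hf k)
  have h2 := ENNReal.Tendsto.mul_const h (Or.inr hct)
  rw [zero_mul] at h2
  exact tendsto_of_tendsto_of_tendsto_of_le_of_le tendsto_const_nhds h2 (fun k => zero_le) hbd

/-- `(3/2 : ℝ≥0∞).toReal = 3/2`. [folklore] -/
theorem toReal_three_halves_eq : ((3 / 2 : ℝ≥0∞)).toReal = 3 / 2 := by
  rw [ENNReal.toReal_div]; norm_num

/-- From `∫⁻ ‖q‖ₑ^{3/2} ≤ Cp < ∞` to `q ∈ L^{3/2}` with `‖q‖_{3/2} ≤ Cp^{2/3}`. [folklore] -/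
theorem memLp_threeHalves_of_lintegral_le {X : Type*} [MeasurableSpace X] {μ : Measure X}
    {q : X → ℝ} (hqm : AEStronglyMeasurable q μ) {Cp : ℝ≥0∞} (hCp : Cp ≠ ⊤)
    (h : ∫⁻ x, ‖q x‖ₑ ^ (3 / 2 : ℝ) ∂μ ≤ Cp) :
    MemLp q (3 / 2) μ ∧ eLpNorm q (3 / 2) μ ≤ Cp ^ (1 / (3 / 2 : ℝ)) := by
  have he : eLpNorm q (3 / 2) μ = (∫⁻ x, ‖q x‖ₑ ^ (3 / 2 : ℝ) ∂μ) ^ (1 / (3 / 2 : ℝ)) := by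
    rw [eLpNorm_eq_lintegral_rpow_enorm_toReal (by norm_num)
      (ENNReal.div_ne_top (by norm_num) (by norm_num)), toReal_three_halves_eq]
  have hle : eLpNorm q (3 / 2) μ ≤ Cp ^ (1 / (3 / 2 : ℝ)) := by
    rw [he]; exact ENNReal.rpow_le_rpow h (by norm_num)
  exact ⟨⟨hqm, hle.trans_lt (ENNReal.rpow_lt_top_of_nonneg (by norm_num) hCp)⟩, hle⟩

/-- **Integrability of the pieces of the right-hand side of the local energy inequality** for
`w ∈ L³`, `q ∈ L^{3/2}` on a finite measure space and a scalar space–time test function `φ`: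
`‖w‖² (∂ₜφ + νΔφ)`, `‖w‖² ⟪w, ∇φ⟫` and `q ⟪w, ∇φ⟫`. [folklore] -/
theorem integrable_lei_pieces {μ : Measure (ℝ × E)} [IsFiniteMeasure μ] (ν : ℝ) {Q : Opens (ℝ × E)}
    {φ : ℝ → E → ℝ} (hφ : IsSpaceTimeTestOn Q φ) {w : ℝ → E → E} {q : ℝ → E → ℝ}
    (hw : MemLp (uncurry w) 3 μ) (hq : MemLp (uncurry q) (3 / 2) μ) :
    Integrable (fun z : ℝ × E => ‖w z.1 z.2‖ ^ 2 * (timeDeriv φ z.1 z.2 + ν * Δ (φ z.1) z.2)) μ ∧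
    Integrable (fun z : ℝ × E => ‖w z.1 z.2‖ ^ 2 * ⟪w z.1 z.2, gradient (φ z.1) z.2⟫) μ ∧
    Integrable (fun z : ℝ × E => q z.1 z.2 * ⟪w z.1 z.2, gradient (φ z.1) z.2⟫) μ := by
  have hT := FunctionSpaces.holderTriple_threeHalves_three
  obtain ⟨C, hC0, -, htC, hgC, hΔC⟩ := hφ.exists_scalar_weights_bound
  have h23 : (2 : ℝ≥0∞) ≤ 3 := by norm_num
  have hw2 : MemLp (uncurry w) 2 μ := hw.mono_exponent h23
  have hwsq : Integrable (fun z : ℝ × E => ‖w z.1 z.2‖ ^ 2) μ :=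
    (memLp_two_iff_integrable_sq_norm hw2.1).1 hw2
  have htm : AEStronglyMeasurable (fun z : ℝ × E => timeDeriv φ z.1 z.2) μ :=
    hφ.continuous_timeDeriv.aestronglyMeasurable
  have hΔm : AEStronglyMeasurable (fun z : ℝ × E => Δ (φ z.1) z.2) μ :=
    hφ.continuous_laplacian_slice.aestronglyMeasurable
  have hgm : AEStronglyMeasurable (fun z : ℝ × E => gradient (φ z.1) z.2) μ :=
    hφ.continuous_slice_gradient.aestronglyMeasurable
  -- `⟪w, ∇φ⟫ ∈ L³` and `‖w‖² ∈ L^{3/2}`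
  have hB : MemLp (fun z : ℝ × E => ⟪w z.1 z.2, gradient (φ z.1) z.2⟫) 3 μ := by
    refine ⟨hw.1.inner hgm, ?_⟩
    have hle : eLpNorm (fun z : ℝ × E => ⟪w z.1 z.2, gradient (φ z.1) z.2⟫) 3 μ ≤
        ENNReal.ofReal C * eLpNorm (uncurry w) 3 μ :=
      eLpNorm_le_mul_eLpNorm_of_ae_le_mul (Eventually.of_forall fun z => by
        rw [mul_comm]
        exact (norm_inner_le_norm _ _).trans (mul_le_mul_of_nonneg_left (hgC z) (norm_nonneg _))) 3
    exact hle.trans_lt (ENNReal.mul_lt_top ENNReal.ofReal_lt_top hw.2)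
  have hA : MemLp (fun z : ℝ × E => ‖w z.1 z.2‖ ^ 2) (3 / 2) μ :=
    ⟨(hw.1.norm.aemeasurable.pow_const 2).aestronglyMeasurable,
      (eLpNorm_norm_sq_threeHalves_le hw.1).trans_lt (ENNReal.mul_lt_top hw.2 hw.2)⟩
  refine ⟨?_, ?_, ?_⟩
  · have hcm : AEStronglyMeasurable
        (fun z : ℝ × E => timeDeriv φ z.1 z.2 + ν * Δ (φ z.1) z.2) μ :=
      htm.add (hΔm.const_mul ν)
    have h := hwsq.bdd_mul hcm (c := C + ‖ν‖ * C) (Eventually.of_forall fun z => ?_)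
    · refine h.congr (Eventually.of_forall fun z => ?_)
      simp only [mul_comm]
    · calc ‖timeDeriv φ z.1 z.2 + ν * Δ (φ z.1) z.2‖
          ≤ ‖timeDeriv φ z.1 z.2‖ + ‖ν * Δ (φ z.1) z.2‖ := norm_add_le _ _
        _ ≤ C + ‖ν‖ * C := by
            rw [norm_mul]
            exact add_le_add (htC z) (mul_le_mul_of_nonneg_left (hΔC z) (norm_nonneg _))
  · exact hA.integrable_mul hB
  · exact hq.integrable_mul hB

/-- **The local energy inequality of a suitable weak solution in set-integral form, with a
prescribed weak gradient.** If `(w, q)` is a suitable weak solution on `Q` (no force) with a weak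
spatial gradient `H`, `w ∈ L³(Q)`, `q ∈ L^{3/2}(Q)`, `|Q| < ∞`, then for every nonnegative test
function `φ` on `Q`, `|H|² φ` is integrable on `Q` and
`2ν ∫_Q |H|² φ ≤ ∫_Q (‖w‖² (∂ₜφ + νΔφ) + (‖w‖² + 2q) ⟪w, ∇φ⟫)` (the iterated integrals of the
definition are integrals over `Q`, and the gradient of the definition agrees with `H` a.e.,
`HasWeakSpatialGradientOn.ae_eq`). [cite: CaffarelliKohnNirenberg1982, §2 (2.5)] -/
theorem IsSuitableWeakSolutionOn.setIntegral_localEnergy {Q : Opens (ℝ × E)}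
    (hQ : volume (Q : Set (ℝ × E)) ≠ ∞) {ν : ℝ} {w : ℝ → E → E} {q : ℝ → E → ℝ}
    {H : ℝ → E → E →L[ℝ] E} (hsol : IsSuitableWeakSolutionOn Q ν 0 w q)
    (hH : HasWeakSpatialGradientOn Q w H)
    (hw : MemLp (uncurry w) 3 (volume.restrict (Q : Set (ℝ × E))))
    (hq : MemLp (uncurry q) (3 / 2) (volume.restrict (Q : Set (ℝ × E))))
    {φ : ℝ → E → ℝ} (hφ : IsSpaceTimeTestOn Q φ) (hφ0 : ∀ t x, 0 ≤ φ t x) :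
    IntegrableOn (fun z : ℝ × E => frobeniusNormSq (H z.1 z.2) * φ z.1 z.2) Q volume ∧
    2 * ν * ∫ z in (Q : Set (ℝ × E)), frobeniusNormSq (H z.1 z.2) * φ z.1 z.2 ≤
      ∫ z in (Q : Set (ℝ × E)), (‖w z.1 z.2‖ ^ 2 * (timeDeriv φ z.1 z.2 + ν * Δ (φ z.1) z.2) +
        (‖w z.1 z.2‖ ^ 2 + 2 * q z.1 z.2) * ⟪w z.1 z.2, gradient (φ z.1) z.2⟫) := by
  set S : Set (ℝ × E) := (Q : Set (ℝ × E)) with hS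
  have hSm : MeasurableSet S := Q.isOpen.measurableSet
  haveI : IsFiniteMeasure (volume.restrict S) :=
    ⟨by rw [Measure.restrict_apply_univ]; exact hQ.lt_top⟩
  obtain ⟨H', hH', hH'2, hLEI⟩ := hsol.localEnergy
  have hineq := hLEI φ hφ hφ0
  obtain ⟨C, hC0, hφC, -, -, -⟩ := hφ.exists_scalar_weights_bound
  set K : Set (ℝ × E) := tsupport (uncurry φ) with hK
  have hKc : IsCompact K := hφ.hasCompactSupport
  have hKQ : K ⊆ S := hφ.tsupport_subset
  -- `|H'|² φ` is integrable on `K`, hence on `Q`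
  have hH'm : AEStronglyMeasurable (uncurry H') (volume.restrict S) :=
    hH'.locallyIntegrableOn_grad.aestronglyMeasurable
  have hfrobm : ∀ {G : ℝ → E → E →L[ℝ] E}, AEStronglyMeasurable (uncurry G) (volume.restrict S) →
      ∀ {s : Set (ℝ × E)}, s ⊆ S →
      AEStronglyMeasurable (fun z : ℝ × E => frobeniusNormSq (G z.1 z.2)) (volume.restrict s) :=
    fun {G} hG {s} hs => (LerayHopfProofs.continuous_frobeniusNormSq.comp_aestronglyMeasurable hG
      ).mono_measure (Measure.restrict_mono hs le_rfl)
  have hφm : ∀ (s : Set (ℝ × E)), AEStronglyMeasurable (fun z : ℝ × E => φ z.1 z.2)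
      (volume.restrict s) := fun s => hφ.contDiff.continuous.aestronglyMeasurable
  have hIK : IntegrableOn (fun z : ℝ × E => frobeniusNormSq (H' z.1 z.2) * φ z.1 z.2) K volume := by
    have hfK : IntegrableOn (fun z : ℝ × E => frobeniusNormSq (H' z.1 z.2)) K volume := by
      refine ⟨hfrobm hH'm hKQ, ?_⟩
      rw [hasFiniteIntegral_iff_enorm]
      refine lt_of_le_of_lt (lintegral_mono fun z => ?_) (hH'2 K hKQ hKc)
      rw [Real.enorm_eq_ofReal (frobeniusNormSq_nonneg _)]
    refine (hfK.mul_const C).mono' ((hfrobm hH'm hKQ).mul (hφm K))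
      (Eventually.of_forall fun z => ?_)
    rw [norm_mul, Real.norm_of_nonneg (frobeniusNormSq_nonneg _)]
    exact mul_le_mul_of_nonneg_left (hφC z) (frobeniusNormSq_nonneg _)
  have h0 : ∀ z, z ∉ K → frobeniusNormSq (H' z.1 z.2) * φ z.1 z.2 = 0 := fun z hz => by
    have hz0 : φ z.1 z.2 = 0 := (image_eq_zero_of_notMem_tsupport hz : uncurry φ z = 0)
    rw [hz0, mul_zero]
  have hIQ' : IntegrableOn (fun z : ℝ × E => frobeniusNormSq (H' z.1 z.2) * φ z.1 z.2) S volume :=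
    hIK.of_forall_sdiff_eq_zero hSm fun z hz => h0 z hz.2
  -- `H = H'` a.e. on `Q`
  have hae : ∀ᵐ z ∂(volume.restrict S),
      frobeniusNormSq (H' z.1 z.2) * φ z.1 z.2 = frobeniusNormSq (H z.1 z.2) * φ z.1 z.2 := by
    filter_upwards [hH.ae_eq hH'] with z hz
    have e : H' z.1 z.2 = H z.1 z.2 := by
      have := hz; simp only [uncurry] at this; exact this.symm
    rw [e]
  have hIQ : IntegrableOn (fun z : ℝ × E => frobeniusNormSq (H z.1 z.2) * φ z.1 z.2) S volume :=
    hIQ'.congr hae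
  refine ⟨hIQ, ?_⟩
  -- the left-hand side as a set integral
  have hL : ∫ t, ∫ x, frobeniusNormSq (H' t x) * φ t x =
      ∫ z in S, frobeniusNormSq (H z.1 z.2) * φ z.1 z.2 := by
    rw [← integral_congr_ae hae]
    exact integral_integral_eq_setIntegral hIQ' fun z hz => h0 z fun h => hz (hKQ h)
  -- the right-hand side as a set integral
  obtain ⟨iA, iB, iC⟩ := integrable_lei_pieces ν hφ hw hq
  have hRint : IntegrableOn (fun z : ℝ × E => ‖w z.1 z.2‖ ^ 2 * (timeDeriv φ z.1 z.2 +
      ν * Δ (φ z.1) z.2) + (‖w z.1 z.2‖ ^ 2 + 2 * q z.1 z.2) * ⟪w z.1 z.2, gradient (φ z.1) z.2⟫ +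
      2 * ⟪(0 : ℝ → E → E) z.1 z.2, w z.1 z.2⟫ * φ z.1 z.2) S volume := by
    have h := iA.add (iB.add (iC.const_mul 2))
    refine h.congr (Eventually.of_forall fun z => ?_)
    simp only [Pi.add_apply, Pi.zero_apply, inner_zero_left, mul_zero, zero_mul, add_zero]
    ring
  have hR0 : ∀ z : ℝ × E, z ∉ S → ‖w z.1 z.2‖ ^ 2 * (timeDeriv φ z.1 z.2 + ν * Δ (φ z.1) z.2) +
      (‖w z.1 z.2‖ ^ 2 + 2 * q z.1 z.2) * ⟪w z.1 z.2, gradient (φ z.1) z.2⟫ +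
      2 * ⟪(0 : ℝ → E → E) z.1 z.2, w z.1 z.2⟫ * φ z.1 z.2 = 0 := by
    intro z hz
    have h1 : deriv (fun s => φ s z.2) z.1 = 0 := hφ.deriv_eq_zero hz
    have h2 : Δ (φ z.1) z.2 = 0 := hφ.laplacian_slice_eq_zero hz
    have h3 : gradient (φ z.1) z.2 = 0 := by
      rw [gradient, hφ.fderiv_slice_eq_zero hz, map_zero]
    have h4 : φ z.1 z.2 = 0 := hφ.apply_eq_zero hz
    simp [h1, h2, h3, h4]
  have hR : ∫ t, ∫ x, (‖w t x‖ ^ 2 * (timeDeriv φ t x + ν * Δ (φ t) x) +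
      (‖w t x‖ ^ 2 + 2 * q t x) * ⟪w t x, gradient (φ t) x⟫ + 2 * ⟪(0 : ℝ → E → E) t x, w t x⟫ *
        φ t x) = ∫ z in S, (‖w z.1 z.2‖ ^ 2 * (timeDeriv φ z.1 z.2 + ν * Δ (φ z.1) z.2) +
        (‖w z.1 z.2‖ ^ 2 + 2 * q z.1 z.2) * ⟪w z.1 z.2, gradient (φ z.1) z.2⟫) := by
    rw [integral_integral_eq_setIntegral hRint hR0]
    refine integral_congr_ae (Eventually.of_forall fun z => ?_)
    simp only [Pi.zero_apply, inner_zero_left, mul_zero, zero_mul, add_zero]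
  rw [hL, hR] at hineq
  exact hineq

/-- **Convergence of the right-hand side of the local energy inequality** along the
compactness-method convergences: `vₖ → u` in `L³`, `πₖ ⇀ p` weakly in `L^{3/2}` with bounded
norms (Bradshaw–Tsai 2019, §4.3: "the right hand sides of the energy inequality for `v^{(k)}`
converge to the right hand side of the energy inequality for `v`"). [cite: BradshawTsai2019, §4.3 (proof of Thm 1.2)] -/
theorem tendsto_setIntegral_lei_rhs {μ : Measure (ℝ × E)} [IsFiniteMeasure μ] (ν : ℝ)
    {Q : Opens (ℝ × E)} {φ : ℝ → E → ℝ} (hφ : IsSpaceTimeTestOn Q φ)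
    {v : ℕ → ℝ → E → E} {π : ℕ → ℝ → E → ℝ} {u : ℝ → E → E} {p : ℝ → E → ℝ} {M : ℝ≥0∞}
    (hM : M ≠ ⊤) (hv : ∀ k, MemLp (uncurry (v k)) 3 μ) (hu : MemLp (uncurry u) 3 μ)
    (hconv : Tendsto (fun k => eLpNorm (uncurry (v k) - uncurry u) 3 μ) atTop (𝓝 0))
    (hπm : ∀ k, AEStronglyMeasurable (uncurry (π k)) μ)
    (hπM : ∀ k, eLpNorm (uncurry (π k)) (3 / 2) μ ≤ M) (hp : MemLp (uncurry p) (3 / 2) μ)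
    (hπw : ∀ g : ℝ × E → ℝ, MemLp g 3 μ →
      Tendsto (fun k => ∫ z, π k z.1 z.2 * g z ∂μ) atTop (𝓝 (∫ z, p z.1 z.2 * g z ∂μ))) :
    Tendsto (fun k => ∫ z, (‖v k z.1 z.2‖ ^ 2 * (timeDeriv φ z.1 z.2 + ν * Δ (φ z.1) z.2) +
        (‖v k z.1 z.2‖ ^ 2 + 2 * π k z.1 z.2) * ⟪v k z.1 z.2, gradient (φ z.1) z.2⟫) ∂μ) atTop
      (𝓝 (∫ z, (‖u z.1 z.2‖ ^ 2 * (timeDeriv φ z.1 z.2 + ν * Δ (φ z.1) z.2) +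
        (‖u z.1 z.2‖ ^ 2 + 2 * p z.1 z.2) * ⟪u z.1 z.2, gradient (φ z.1) z.2⟫) ∂μ)) := by
  obtain ⟨C, hC0, -, htC, hgC, hΔC⟩ := hφ.exists_scalar_weights_bound
  have h23 : (2 : ℝ≥0∞) ≤ 3 := by norm_num
  have htm : AEStronglyMeasurable (fun z : ℝ × E => timeDeriv φ z.1 z.2) μ :=
    hφ.continuous_timeDeriv.aestronglyMeasurable
  have hΔm : AEStronglyMeasurable (fun z : ℝ × E => Δ (φ z.1) z.2) μ :=
    hφ.continuous_laplacian_slice.aestronglyMeasurable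
  have hgm : AEStronglyMeasurable (fun z : ℝ × E => gradient (φ z.1) z.2) μ :=
    hφ.continuous_slice_gradient.aestronglyMeasurable
  have hcm : AEStronglyMeasurable (fun z : ℝ × E => timeDeriv φ z.1 z.2 + ν * Δ (φ z.1) z.2) μ :=
    htm.add (hΔm.const_mul ν)
  have hcb : ∀ z : ℝ × E, ‖timeDeriv φ z.1 z.2 + ν * Δ (φ z.1) z.2‖ ≤ C + ‖ν‖ * C := fun z =>
    calc ‖timeDeriv φ z.1 z.2 + ν * Δ (φ z.1) z.2‖
        ≤ ‖timeDeriv φ z.1 z.2‖ + ‖ν * Δ (φ z.1) z.2‖ := norm_add_le _ _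
      _ ≤ C + ‖ν‖ * C := by
          rw [norm_mul]
          exact add_le_add (htC z) (mul_le_mul_of_nonneg_left (hΔC z) (norm_nonneg _))
  -- splitting of the integrals
  have hsplit : ∀ {w : ℝ → E → E} {q : ℝ → E → ℝ}, MemLp (uncurry w) 3 μ →
      MemLp (uncurry q) (3 / 2) μ →
      ∫ z, (‖w z.1 z.2‖ ^ 2 * (timeDeriv φ z.1 z.2 + ν * Δ (φ z.1) z.2) +
        (‖w z.1 z.2‖ ^ 2 + 2 * q z.1 z.2) * ⟪w z.1 z.2, gradient (φ z.1) z.2⟫) ∂μ =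
      (∫ z, (timeDeriv φ z.1 z.2 + ν * Δ (φ z.1) z.2) * ‖w z.1 z.2‖ ^ 2 ∂μ) +
        ((∫ z, ‖w z.1 z.2‖ ^ 2 * ⟪w z.1 z.2, gradient (φ z.1) z.2⟫ ∂μ) +
          2 * ∫ z, q z.1 z.2 * ⟪w z.1 z.2, gradient (φ z.1) z.2⟫ ∂μ) := by
    intro w q hw hq
    obtain ⟨iA, iB, iC⟩ := integrable_lei_pieces ν hφ hw hq
    have iA' : Integrable (fun z : ℝ × E => (timeDeriv φ z.1 z.2 + ν * Δ (φ z.1) z.2) *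
        ‖w z.1 z.2‖ ^ 2) μ := iA.congr (Eventually.of_forall fun z => mul_comm _ _)
    have iC2 : Integrable (fun z : ℝ × E => 2 * (q z.1 z.2 * ⟪w z.1 z.2, gradient (φ z.1) z.2⟫)) μ :=
      iC.const_mul 2
    have iBC : Integrable (fun z : ℝ × E => ‖w z.1 z.2‖ ^ 2 * ⟪w z.1 z.2, gradient (φ z.1) z.2⟫ +
        2 * (q z.1 z.2 * ⟪w z.1 z.2, gradient (φ z.1) z.2⟫)) μ := iB.add iC2
    have e1 := integral_add iA' iBC
    have e2 := integral_add iB iC2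
    have e3 := integral_const_mul (μ := μ) (2 : ℝ)
      (fun z : ℝ × E => q z.1 z.2 * ⟪w z.1 z.2, gradient (φ z.1) z.2⟫)
    rw [← e3, ← e2, ← e1]
    refine integral_congr_ae (Eventually.of_forall fun z => ?_)
    ring
  have hlimA := FunctionSpaces.tendsto_integral_mul_norm_sq (μ := μ) (fun k => (hv k).1)
    (hu.mono_exponent h23) (tendsto_eLpNorm_two_of_three (fun k => (hv k).1.sub hu.1) hconv) hcm
    (by positivity) hcb
  have hlimB := tendsto_integral_norm_sq_mul_inner (μ := μ) hv hu hconv hgm hgC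
  have hlimC := tendsto_integral_mul_inner_of_weak_strong (μ := μ) (π := fun k => uncurry (π k))
    (p := uncurry p) hM hπm hπM hπw hv hu hconv hgm hgC
  have hlim := hlimA.add (hlimB.add (hlimC.const_mul 2))
  rw [hsplit hu hp]
  refine hlim.congr fun k => ?_
  rw [hsplit (hv k) ⟨hπm k, (hπM k).trans_lt hM.lt_top⟩]
  rfl

end LocalEnergy

/-! ### The stability theorem -/

section Stability

variable {E : Type*} [NormedAddCommGroup E] [InnerProductSpace ℝ E] [FiniteDimensional ℝ E]
  [MeasurableSpace E] [BorelSpace E]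

/-- The iterated integral of the right-hand side of the local energy inequality (no force) over
`ℝ × E` is the integral over `Q` of `‖w‖² (∂ₜφ + νΔφ) + (‖w‖² + 2q) ⟪w, ∇φ⟫`, for `w ∈ L³(Q)`,
`q ∈ L^{3/2}(Q)`, `|Q| < ∞` (all weights vanish off `Q`). [folklore] -/
theorem integral_integral_lei_rhs_eq {Q : Opens (ℝ × E)} (hQ : volume (Q : Set (ℝ × E)) ≠ ∞)
    (ν : ℝ) {w : ℝ → E → E} {q : ℝ → E → ℝ}
    (hw : MemLp (uncurry w) 3 (volume.restrict (Q : Set (ℝ × E))))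
    (hq : MemLp (uncurry q) (3 / 2) (volume.restrict (Q : Set (ℝ × E))))
    {φ : ℝ → E → ℝ} (hφ : IsSpaceTimeTestOn Q φ) :
    ∫ t, ∫ x, (‖w t x‖ ^ 2 * (timeDeriv φ t x + ν * Δ (φ t) x) +
      (‖w t x‖ ^ 2 + 2 * q t x) * ⟪w t x, gradient (φ t) x⟫ + 2 * ⟪(0 : ℝ → E → E) t x, w t x⟫ *
        φ t x) = ∫ z in (Q : Set (ℝ × E)), (‖w z.1 z.2‖ ^ 2 * (timeDeriv φ z.1 z.2 + ν * Δ (φ z.1) z.2) +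
        (‖w z.1 z.2‖ ^ 2 + 2 * q z.1 z.2) * ⟪w z.1 z.2, gradient (φ z.1) z.2⟫) := by
  set S : Set (ℝ × E) := (Q : Set (ℝ × E)) with hS
  haveI : IsFiniteMeasure (volume.restrict S) :=
    ⟨by rw [Measure.restrict_apply_univ]; exact hQ.lt_top⟩
  obtain ⟨iA, iB, iC⟩ := integrable_lei_pieces ν hφ hw hq
  have hRint : IntegrableOn (fun z : ℝ × E => ‖w z.1 z.2‖ ^ 2 * (timeDeriv φ z.1 z.2 +
      ν * Δ (φ z.1) z.2) + (‖w z.1 z.2‖ ^ 2 + 2 * q z.1 z.2) * ⟪w z.1 z.2, gradient (φ z.1) z.2⟫ +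
      2 * ⟪(0 : ℝ → E → E) z.1 z.2, w z.1 z.2⟫ * φ z.1 z.2) S volume := by
    have h := iA.add (iB.add (iC.const_mul 2))
    refine h.congr (Eventually.of_forall fun z => ?_)
    simp only [Pi.add_apply, Pi.zero_apply, inner_zero_left, mul_zero, zero_mul, add_zero]
    ring
  have hR0 : ∀ z : ℝ × E, z ∉ S → ‖w z.1 z.2‖ ^ 2 * (timeDeriv φ z.1 z.2 + ν * Δ (φ z.1) z.2) +
      (‖w z.1 z.2‖ ^ 2 + 2 * q z.1 z.2) * ⟪w z.1 z.2, gradient (φ z.1) z.2⟫ +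
      2 * ⟪(0 : ℝ → E → E) z.1 z.2, w z.1 z.2⟫ * φ z.1 z.2 = 0 := by
    intro z hz
    have h1 : deriv (fun s => φ s z.2) z.1 = 0 := hφ.deriv_eq_zero hz
    have h2 : Δ (φ z.1) z.2 = 0 := hφ.laplacian_slice_eq_zero hz
    have h3 : gradient (φ z.1) z.2 = 0 := by
      rw [gradient, hφ.fderiv_slice_eq_zero hz, map_zero]
    have h4 : φ z.1 z.2 = 0 := hφ.apply_eq_zero hz
    simp [h1, h2, h3, h4]
  rw [integral_integral_eq_setIntegral hRint hR0]
  refine integral_congr_ae (Eventually.of_forall fun z => ?_)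
  simp only [Pi.zero_apply, inner_zero_left, mul_zero, zero_mul, add_zero]

/-- The iterated integral `∫∫ |H|² φ` over `ℝ × E` is the integral over `Q` when `|H|² φ` is
integrable on `Q` (`φ` a test function on `Q` vanishes off `Q`). [folklore] -/
theorem integral_integral_frobeniusNormSq_mul_eq {Q : Opens (ℝ × E)} {H : ℝ → E → E →L[ℝ] E}
    {φ : ℝ → E → ℝ} (hφ : IsSpaceTimeTestOn Q φ)
    (hI : IntegrableOn (fun z : ℝ × E => frobeniusNormSq (H z.1 z.2) * φ z.1 z.2) Q volume) :
    ∫ t, ∫ x, frobeniusNormSq (H t x) * φ t x =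
      ∫ z in (Q : Set (ℝ × E)), frobeniusNormSq (H z.1 z.2) * φ z.1 z.2 :=
  integral_integral_eq_setIntegral hI fun z hz => by rw [hφ.apply_eq_zero hz, mul_zero]

/-- **A limit of suitable weak solutions is a suitable weak solution** (the stability half of the
compactness of suitable weak solutions: Caffarelli–Kohn–Nirenberg 1982, §2 and Appendix;
Lin 1998, Thm. 2.2; Lemarié-Rieusset 2016, Thm. 14.1, Steps 3–4; Bradshaw–Tsai 2019, §4.3). Let
`Q` be an open space–time region of finite measure and `(vₖ, πₖ)` suitable weak solutions on
`Q` (viscosity `ν ≥ 0`, no force) with weak spatial gradients `Gₖ`, `vₖ ∈ L³(Q)` and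
`∫_Q |πₖ|^{3/2} ≤ C_p`. Assume `vₖ → u` in `L³(Q)`; `πₖ ⇀ p` weakly in `L^{3/2}(Q)` (pairings
with `L³(Q)` converge) with `∫_Q |p|^{3/2} ≤ C_p`; `Gₖ a ⇀ G a` weakly in `L²(Q; E)` for every
direction `a`, where `G` is a weak spatial gradient of `u` on `Q` with `∫_Q |G|² < ∞`; and
`u ∈ L^∞_t L²_x` on compact subsets of `Q`. Then `(u, p)` is a suitable weak solution on `Q`
(with gradient `G`): the divergence condition and the momentum equation pass to the limit term by
term (`L²` suffices for the quadratic term), the right-hand side of the local energy inequality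
converges (`tendsto_setIntegral_lei_rhs`) and its left-hand side is weakly lower semicontinuous
(`lintegral_frobeniusNormSq_mul_le_of_tendsto`) — "the right hand sides of the energy inequality
for `v^{(k)}` converge … while the left hand-sides are lower semi-continuous (cf. [CKN]). The
local energy inequality for `v` plainly follows." [cite: BradshawTsai2019, §4.3 (proof of Thm 1.2)] [cite: CaffarelliKohnNirenberg1982, §2 (2.5)] -/
theorem isSuitableWeakSolutionOn_of_tendsto {Q : Opens (ℝ × E)}
    (hQ : volume (Q : Set (ℝ × E)) ≠ ∞) {ν : ℝ} (hν : 0 ≤ ν)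
    {v : ℕ → ℝ → E → E} {π : ℕ → ℝ → E → ℝ} {G : ℕ → ℝ → E → E →L[ℝ] E}
    {u : ℝ → E → E} {p : ℝ → E → ℝ} {Gu : ℝ → E → E →L[ℝ] E} {Cp : ℝ≥0∞} (hCp : Cp ≠ ∞)
    (hsol : ∀ k, IsSuitableWeakSolutionOn Q ν 0 (v k) (π k))
    (hG : ∀ k, HasWeakSpatialGradientOn Q (v k) (G k))
    (hv3 : ∀ k, MemLp (uncurry (v k)) 3 (volume.restrict (Q : Set (ℝ × E))))
    (hπb : ∀ k, ∫⁻ z in (Q : Set (ℝ × E)), ‖π k z.1 z.2‖ₑ ^ (3 / 2 : ℝ) ≤ Cp)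
    (hu3 : MemLp (uncurry u) 3 (volume.restrict (Q : Set (ℝ × E))))
    (hpm : AEStronglyMeasurable (uncurry p) (volume.restrict (Q : Set (ℝ × E))))
    (hpb : ∫⁻ z in (Q : Set (ℝ × E)), ‖p z.1 z.2‖ₑ ^ (3 / 2 : ℝ) ≤ Cp)
    (hGu : HasWeakSpatialGradientOn Q u Gu)
    (hGu2 : ∫⁻ z in (Q : Set (ℝ × E)), ENNReal.ofReal (frobeniusNormSq (Gu z.1 z.2)) < ∞)
    (huE : ∀ K ⊆ (Q : Set (ℝ × E)), IsCompact K → ∃ C : ℝ≥0, ∀ᵐ t : ℝ,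
      ∫⁻ x, K.indicator (fun z : ℝ × E => ‖u z.1 z.2‖ₑ ^ 2) (t, x) ≤ C)
    (hconv : Tendsto (fun k => eLpNorm (uncurry (v k) - uncurry u) 3
      (volume.restrict (Q : Set (ℝ × E)))) atTop (𝓝 0))
    (hπw : ∀ g : ℝ × E → ℝ, MemLp g 3 (volume.restrict (Q : Set (ℝ × E))) →
      Tendsto (fun k => ∫ z in (Q : Set (ℝ × E)), π k z.1 z.2 * g z) atTop
        (𝓝 (∫ z in (Q : Set (ℝ × E)), p z.1 z.2 * g z)))
    (hGw : ∀ (a : E) (h : ℝ × E → E), MemLp h 2 (volume.restrict (Q : Set (ℝ × E))) →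
      Tendsto (fun k => ∫ z in (Q : Set (ℝ × E)), ⟪G k z.1 z.2 a, h z⟫) atTop
        (𝓝 (∫ z in (Q : Set (ℝ × E)), ⟪Gu z.1 z.2 a, h z⟫))) :
    IsSuitableWeakSolutionOn Q ν 0 u p := by
  set S : Set (ℝ × E) := (Q : Set (ℝ × E)) with hS
  have hSm : MeasurableSet S := Q.isOpen.measurableSet
  set μQ : Measure (ℝ × E) := volume.restrict S with hμQ
  haveI : IsFiniteMeasure μQ := ⟨by rw [hμQ, Measure.restrict_apply_univ]; exact hQ.lt_top⟩
  have h13 : (1 : ℝ≥0∞) ≤ 3 := by norm_num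
  have h23 : (2 : ℝ≥0∞) ≤ 3 := by norm_num
  have h132 : (1 : ℝ≥0∞) ≤ 3 / 2 := FunctionSpaces.ennreal_one_le_three_halves
  -- memberships
  have hv2 : ∀ k, MemLp (uncurry (v k)) 2 μQ := fun k => (hv3 k).mono_exponent h23
  have hu2 : MemLp (uncurry u) 2 μQ := hu3.mono_exponent h23
  have hu1 : Integrable (uncurry u) μQ := hu3.integrable h13
  have hconv2 : Tendsto (fun k => eLpNorm (uncurry (v k) - uncurry u) 2 μQ) atTop (𝓝 0) :=
    tendsto_eLpNorm_two_of_three (fun k => (hv3 k).1.sub hu3.1) hconv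
  have hπm : ∀ k, AEStronglyMeasurable (uncurry (π k)) μQ := fun k =>
    (hsol k).distributional.2.2.1.aestronglyMeasurable
  have hπmem : ∀ k, MemLp (uncurry (π k)) (3 / 2) μQ ∧
      eLpNorm (uncurry (π k)) (3 / 2) μQ ≤ Cp ^ (1 / (3 / 2 : ℝ)) := fun k =>
    memLp_threeHalves_of_lintegral_le (hπm k) hCp (hπb k)
  have hpmem := memLp_threeHalves_of_lintegral_le hpm hCp hpb
  have hMt : Cp ^ (1 / (3 / 2 : ℝ)) ≠ ⊤ := ENNReal.rpow_ne_top_of_nonneg (by norm_num) hCp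
  have hp1 : Integrable (uncurry p) μQ := hpmem.1.integrable h132
  have hπ1 : ∀ k, Integrable (uncurry (π k)) μQ := fun k => (hπmem k).1.integrable h132
  ------------------------------------------------------------------
  -- (1) the distributional equations
  ------------------------------------------------------------------
  have hdist : IsDistributionalNSSolutionOn Q ν 0 u p := by
    refine ⟨IntegrableOn.locallyIntegrableOn hu1, ?_, IntegrableOn.locallyIntegrableOn hp1,
      fun θ hθ => ?_, fun ψ hψ => ?_⟩
    · exact IntegrableOn.locallyIntegrableOn ((memLp_two_iff_integrable_sq_norm hu2.1).1 hu2)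
    · -- divergence free
      obtain ⟨C, hC0, -, -, hgC, -⟩ := hθ.exists_scalar_weights_bound
      have hw : AEStronglyMeasurable (fun z : ℝ × E => gradient (θ z.1) z.2) μQ :=
        hθ.continuous_slice_gradient.aestronglyMeasurable
      have hlim : Tendsto (fun k => ∫ z, ⟪uncurry (v k) z, gradient (θ z.1) z.2⟫ ∂μQ) atTop
          (𝓝 (∫ z, ⟪uncurry u z, gradient (θ z.1) z.2⟫ ∂μQ)) :=
        tendsto_integral_inner_of_tendsto_eLpNorm_two_bdd hv2 hu2 hconv2 hw hC0 hgC
      have h0 : ∀ k, ∫ z, ⟪uncurry (v k) z, gradient (θ z.1) z.2⟫ ∂μQ = 0 := fun k =>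
        (hsol k).distributional.2.2.2.1 θ hθ
      simp only [h0] at hlim
      exact (tendsto_nhds_unique tendsto_const_nhds hlim).symm
    · -- the momentum equation
      obtain ⟨C, hC0, htC, hDC, hΔC, hdivC⟩ := hψ.exists_weights_bound
      have htm : AEStronglyMeasurable (fun z : ℝ × E => timeDeriv ψ z.1 z.2) μQ :=
        hψ.continuous_timeDeriv.aestronglyMeasurable
      have hDm : AEStronglyMeasurable (fun z : ℝ × E => fderiv ℝ (ψ z.1) z.2) μQ :=
        hψ.continuous_fderiv_slice.aestronglyMeasurable
      have hΔm : AEStronglyMeasurable (fun z : ℝ × E => Δ (ψ z.1) z.2) μQ :=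
        hψ.continuous_laplacian_slice.aestronglyMeasurable
      have hdivm : AEStronglyMeasurable (fun z : ℝ × E => VectorCalculus.divergence (ψ z.1) z.2) μQ :=
        hψ.continuous_divergence_slice.aestronglyMeasurable
      have hdiv3 : MemLp (fun z : ℝ × E => VectorCalculus.divergence (ψ z.1) z.2) 3 μQ :=
        (memLp_top_of_bound hdivm C (Eventually.of_forall hdivC)).mono_exponent le_top
      have happ : Continuous (uncurry fun (T : E →L[ℝ] E) (x : E) => T x) :=
        isBoundedBilinearMap_apply.continuous
      -- splitting of the tested integrand
      have hsplit : ∀ {w : ℝ → E → E} {q : ℝ → E → ℝ}, MemLp (uncurry w) 2 μQ →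
          Integrable (uncurry q) μQ →
          ∫ z, (⟪w z.1 z.2, timeDeriv ψ z.1 z.2⟫ + ⟪w z.1 z.2, convect (w z.1) (ψ z.1) z.2⟫ +
            ν * ⟪w z.1 z.2, Δ (ψ z.1) z.2⟫ + q z.1 z.2 * VectorCalculus.divergence (ψ z.1) z.2 +
            ⟪(0 : ℝ → E → E) z.1 z.2, ψ z.1 z.2⟫) ∂μQ =
          ((∫ z, ⟪uncurry w z, timeDeriv ψ z.1 z.2⟫ ∂μQ) +
            ∫ z, ⟪uncurry w z, fderiv ℝ (ψ z.1) z.2 (uncurry w z)⟫ ∂μQ) +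
          (ν * ∫ z, ⟪uncurry w z, Δ (ψ z.1) z.2⟫ ∂μQ +
            ∫ z, uncurry q z * VectorCalculus.divergence (ψ z.1) z.2 ∂μQ) := by
        intro w q hw hq
        have hw1 : Integrable (uncurry w) μQ := hw.integrable one_le_two
        have hbd : ∀ {g : ℝ × E → E}, AEStronglyMeasurable g μQ → (∀ z, ‖g z‖ ≤ C) →
            Integrable (fun z => ⟪uncurry w z, g z⟫) μQ := fun {g} hg hgC => by
          refine (hw1.norm.mul_const C).mono' (hw.1.inner hg) (Eventually.of_forall fun z => ?_)
          exact (norm_inner_le_norm _ _).trans (mul_le_mul_of_nonneg_left (hgC z) (norm_nonneg _))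
        have i1 := hbd htm htC
        have i2 : Integrable (fun z => ⟪uncurry w z, fderiv ℝ (ψ z.1) z.2 (uncurry w z)⟫) μQ := by
          have hm : AEStronglyMeasurable (fun z => fderiv ℝ (ψ z.1) z.2 (uncurry w z)) μQ :=
            happ.comp_aestronglyMeasurable₂ hDm hw.1
          have h2 : Integrable (fun z => ‖uncurry w z‖ ^ 2) μQ :=
            (memLp_two_iff_integrable_sq_norm hw.1).1 hw
          refine (h2.const_mul C).mono' (hw.1.inner hm) (Eventually.of_forall fun z => ?_)
          calc ‖⟪uncurry w z, fderiv ℝ (ψ z.1) z.2 (uncurry w z)⟫‖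
              ≤ ‖uncurry w z‖ * ‖fderiv ℝ (ψ z.1) z.2 (uncurry w z)‖ := norm_inner_le_norm _ _
            _ ≤ ‖uncurry w z‖ * (C * ‖uncurry w z‖) := by
                gcongr
                exact (ContinuousLinearMap.le_opNorm _ _).trans
                  (mul_le_mul_of_nonneg_right (hDC z) (norm_nonneg _))
            _ = C * ‖uncurry w z‖ ^ 2 := by ring
        have i3 : Integrable (fun z => ν * ⟪uncurry w z, Δ (ψ z.1) z.2⟫) μQ := (hbd hΔm hΔC).const_mul ν
        have i4 : Integrable (fun z => uncurry q z * VectorCalculus.divergence (ψ z.1) z.2) μQ :=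
          (hq.bdd_mul hdivm (Eventually.of_forall hdivC)).congr
            (Eventually.of_forall fun z => mul_comm _ _)
        have i12 : Integrable (fun z => ⟪uncurry w z, timeDeriv ψ z.1 z.2⟫ +
            ⟪uncurry w z, fderiv ℝ (ψ z.1) z.2 (uncurry w z)⟫) μQ := i1.add i2
        have i34 : Integrable (fun z => ν * ⟪uncurry w z, Δ (ψ z.1) z.2⟫ +
            uncurry q z * VectorCalculus.divergence (ψ z.1) z.2) μQ := i3.add i4
        have e1 := integral_add i1 i2
        have e2 := integral_add i3 i4
        have e12 := integral_add i12 i34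
        have e3 := integral_const_mul (μ := μQ) ν (fun z : ℝ × E => ⟪uncurry w z, Δ (ψ z.1) z.2⟫)
        rw [← e3, ← e1, ← e2, ← e12]
        refine integral_congr_ae (Eventually.of_forall fun z => ?_)
        simp only [convect, uncurry, Pi.zero_apply, inner_zero_left, add_zero]
        ring
      -- the limits of the four pieces
      have hl1 : Tendsto (fun k => ∫ z, ⟪uncurry (v k) z, timeDeriv ψ z.1 z.2⟫ ∂μQ) atTop
          (𝓝 (∫ z, ⟪uncurry u z, timeDeriv ψ z.1 z.2⟫ ∂μQ)) :=
        tendsto_integral_inner_of_tendsto_eLpNorm_two_bdd hv2 hu2 hconv2 htm hC0 htC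
      have hl2 : Tendsto (fun k => ∫ z, ⟪uncurry (v k) z, fderiv ℝ (ψ z.1) z.2 (uncurry (v k) z)⟫ ∂μQ)
          atTop (𝓝 (∫ z, ⟪uncurry u z, fderiv ℝ (ψ z.1) z.2 (uncurry u z)⟫ ∂μQ)) :=
        tendsto_integral_inner_clm_apply_of_tendsto_eLpNorm hv2 hu2 hconv2 hDm hC0 hDC
      have hl3 : Tendsto (fun k => ν * ∫ z, ⟪uncurry (v k) z, Δ (ψ z.1) z.2⟫ ∂μQ) atTop
          (𝓝 (ν * ∫ z, ⟪uncurry u z, Δ (ψ z.1) z.2⟫ ∂μQ)) :=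
        (tendsto_integral_inner_of_tendsto_eLpNorm_two_bdd hv2 hu2 hconv2 hΔm hC0 hΔC).const_mul ν
      have hl4 : Tendsto (fun k => ∫ z, uncurry (π k) z * VectorCalculus.divergence (ψ z.1) z.2 ∂μQ)
          atTop (𝓝 (∫ z, uncurry p z * VectorCalculus.divergence (ψ z.1) z.2 ∂μQ)) :=
        hπw _ hdiv3
      have hlim := (hl1.add hl2).add (hl3.add hl4)
      have hk : ∀ k, ((∫ z, ⟪uncurry (v k) z, timeDeriv ψ z.1 z.2⟫ ∂μQ) +
          ∫ z, ⟪uncurry (v k) z, fderiv ℝ (ψ z.1) z.2 (uncurry (v k) z)⟫ ∂μQ) +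
          (ν * ∫ z, ⟪uncurry (v k) z, Δ (ψ z.1) z.2⟫ ∂μQ +
            ∫ z, uncurry (π k) z * VectorCalculus.divergence (ψ z.1) z.2 ∂μQ) = 0 := fun k => by
        rw [← hsplit (hv2 k) (hπ1 k)]
        exact (hsol k).distributional.2.2.2.2 ψ hψ
      simp only [hk] at hlim
      have h := tendsto_nhds_unique tendsto_const_nhds hlim
      rw [hsplit hu2 hp1]
      exact h.symm
  ------------------------------------------------------------------
  -- (2)–(4) the classes and the local energy inequality
  ------------------------------------------------------------------
  refine
    { distributional := hdist
      energyClass := huE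
      pressure := fun K hK _ => (lintegral_mono_set hK).trans_lt (hpb.trans_lt hCp.lt_top)
      localEnergy := ⟨Gu, hGu, fun K hK _ => (lintegral_mono_set hK).trans_lt hGu2, ?_⟩ }
  intro φ hφ hφ0
  obtain ⟨C, hC0, hφC, -, -, -⟩ := hφ.exists_scalar_weights_bound
  -- the local energy inequalities of the `vₖ`, in set-integral form with the gradients `Gₖ`
  have hk := fun k => (hsol k).setIntegral_localEnergy hQ (hG k) (hv3 k) (hπmem k).1 hφ hφ0
  -- convergence of the right-hand sides
  have hR := tendsto_setIntegral_lei_rhs (μ := μQ) ν hφ hMt hv3 hu3 hconv hπm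
    (fun k => (hπmem k).2) hpmem.1 hπw
  set Ru : ℝ := ∫ z, (‖u z.1 z.2‖ ^ 2 * (timeDeriv φ z.1 z.2 + ν * Δ (φ z.1) z.2) +
    (‖u z.1 z.2‖ ^ 2 + 2 * p z.1 z.2) * ⟪u z.1 z.2, gradient (φ z.1) z.2⟫) ∂μQ with hRu
  -- `|Gu|² φ` is integrable on `Q`
  have hGum : AEStronglyMeasurable (uncurry Gu) μQ := hGu.locallyIntegrableOn_grad.aestronglyMeasurable
  have hGm : ∀ k, AEStronglyMeasurable (uncurry (G k)) μQ := fun k =>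
    (hG k).locallyIntegrableOn_grad.aestronglyMeasurable
  have hφm : AEStronglyMeasurable (uncurry φ) μQ := hφ.contDiff.continuous.aestronglyMeasurable
  have hfrobm : AEStronglyMeasurable (fun z : ℝ × E => frobeniusNormSq (Gu z.1 z.2)) μQ :=
    LerayHopfProofs.continuous_frobeniusNormSq.comp_aestronglyMeasurable hGum
  have hIGu : IntegrableOn (fun z : ℝ × E => frobeniusNormSq (Gu z.1 z.2) * φ z.1 z.2) S volume := by
    have hf : Integrable (fun z : ℝ × E => frobeniusNormSq (Gu z.1 z.2)) μQ := by
      refine ⟨hfrobm, ?_⟩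
      rw [hasFiniteIntegral_iff_enorm]
      refine lt_of_le_of_lt (lintegral_mono fun z => ?_) hGu2
      rw [Real.enorm_eq_ofReal (frobeniusNormSq_nonneg _)]
    refine (hf.mul_const C).mono' (hfrobm.mul hφm) (Eventually.of_forall fun z => ?_)
    rw [norm_mul, Real.norm_of_nonneg (frobeniusNormSq_nonneg _)]
    exact mul_le_mul_of_nonneg_left (hφC z) (frobeniusNormSq_nonneg _)
  -- pass to set integrals
  rw [integral_integral_frobeniusNormSq_mul_eq hφ hIGu, integral_integral_lei_rhs_eq hQ ν hu3 hpmem.1 hφ]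
  change 2 * ν * ∫ z, frobeniusNormSq (Gu z.1 z.2) * φ z.1 z.2 ∂μQ ≤ Ru
  -- nonnegativity of the right-hand sides
  have hRk0 : ∀ k, 0 ≤ ∫ z, (‖v k z.1 z.2‖ ^ 2 * (timeDeriv φ z.1 z.2 + ν * Δ (φ z.1) z.2) +
      (‖v k z.1 z.2‖ ^ 2 + 2 * π k z.1 z.2) * ⟪v k z.1 z.2, gradient (φ z.1) z.2⟫) ∂μQ := fun k => by
    refine le_trans ?_ (hk k).2
    exact mul_nonneg (mul_nonneg zero_le_two hν)
      (integral_nonneg fun z => mul_nonneg (frobeniusNormSq_nonneg _) (hφ0 _ _))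
  have hRu0 : 0 ≤ Ru := ge_of_tendsto' hR hRk0
  rcases hν.eq_or_lt with hν0 | hνpos
  · rw [← hν0, mul_zero, zero_mul]
    exact hRu0
  -- `ν > 0`: weak lower semicontinuity for every `ε > 0`
  have h2ν : 0 < 2 * ν := by positivity
  set I : ℝ := ∫ z, frobeniusNormSq (Gu z.1 z.2) * φ z.1 z.2 ∂μQ with hI
  suffices hmain : ∀ ε, 0 < ε → 2 * ν * I ≤ Ru + ε from le_of_forall_pos_le_add hmain
  intro ε hε
  set B : ℝ≥0∞ := ENNReal.ofReal ((Ru + ε) / (2 * ν)) with hB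
  have hev : ∀ᶠ k in atTop, ∫⁻ z, ENNReal.ofReal (frobeniusNormSq (uncurry (G k) z) * uncurry φ z) ∂μQ
      ≤ B := by
    filter_upwards [(tendsto_order.1 hR).2 (Ru + ε) (lt_add_of_pos_right _ hε)] with k hklt
    have hint : Integrable (fun z : ℝ × E => frobeniusNormSq (G k z.1 z.2) * φ z.1 z.2) μQ := (hk k).1
    have hnn : 0 ≤ᵐ[μQ] fun z : ℝ × E => frobeniusNormSq (G k z.1 z.2) * φ z.1 z.2 :=
      Eventually.of_forall fun z => mul_nonneg (frobeniusNormSq_nonneg _) (hφ0 _ _)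
    have e := ofReal_integral_eq_lintegral_ofReal hint hnn
    change ∫⁻ z, ENNReal.ofReal (frobeniusNormSq (G k z.1 z.2) * φ z.1 z.2) ∂μQ ≤ B
    rw [← e, hB]
    refine ENNReal.ofReal_le_ofReal ?_
    rw [le_div_iff₀ h2ν, mul_comm]
    exact (hk k).2.trans hklt.le
  have hlsc := lintegral_frobeniusNormSq_mul_le_of_tendsto (μ := μQ) (G := fun k => uncurry (G k))
    (Gu := uncurry Gu) (φ := uncurry φ) (C := C) hGm hGum hGu2 hφm (fun z => hφ0 _ _)
    (fun z => (le_abs_self _).trans ((Real.norm_eq_abs _).symm.le.trans (hφC z))) hGw hev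
  -- back to real numbers
  have hnn : 0 ≤ᵐ[μQ] fun z : ℝ × E => frobeniusNormSq (Gu z.1 z.2) * φ z.1 z.2 :=
    Eventually.of_forall fun z => mul_nonneg (frobeniusNormSq_nonneg _) (hφ0 _ _)
  have e := ofReal_integral_eq_lintegral_ofReal hIGu hnn
  change ∫⁻ z, ENNReal.ofReal (frobeniusNormSq (Gu z.1 z.2) * φ z.1 z.2) ∂μQ ≤ B at hlsc
  rw [← e, hB, ENNReal.ofReal_le_ofReal_iff (div_nonneg (by linarith) h2ν.le)] at hlsc
  rw [mul_comm, ← le_div_iff₀ h2ν]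
  exact hlsc

end Stability

end Literature.Analysis.FluidPDE

end
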